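import Literature.Probability.LatticeModels.SourcedDoubleCurrentsSwitching
import Literature.Probability.LatticeModels.CurrentInsertion
import Literature.Probability.LatticeModels.DoubleCurrentsInfiniteProofs
import Literature.Probability.LatticeModels.PlanarIsingCriticalMagnetization
import Literature.Probability.LatticeModels.PlanarIsingCriticalBeta
import Literature.Probability.LatticeModels.GibbsStatesProofs
import Literature.Probability.LatticeModels.SourcedCurrentLaw
import HarnessLib

/-!
# ADC21 (3.10) in infinite volume, proved: the discharge of
# `freeCorr_mul_eq_sourcedDoubleCurrent_subcurrent`

Topic `Probability/LatticeModels`; namespace `Literature.Probability.LatticeModels`. Proof-only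
companion of `SourcedDoubleCurrentsSwitching.lean` (no definitions, no named facts): it proves
`theorem freeCorr_mul_eq_sourcedDoubleCurrent_subcurrent_holds :
freeCorr_mul_eq_sourcedDoubleCurrent_subcurrent d` — for the nearest-neighbour Ising model on
`ℤ^d`, `d ≥ 2`, `0 ≤ β ≤ β_c(d)` and finite `A, B ⊂ ℤ^d`,
`⟨σ_A⟩⁰_β ⟨σ_B⟩⁰_β = ⟨σ_{A∆B}⟩⁰_β · P^{A∆B,∅}_β[n̂₁ ∪ n̂₂ ∈ 𝓕_B]`.

## Source

M. Aizenman, H. Duminil-Copin, *Marginal triviality of the scaling limits of critical 4D Ising and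
`λφ⁴₄` models*, Ann. of Math. **194** (2021) 163–235 = arXiv:1912.07973 (bib key
`AizenmanDuminilCopinAnnals2021`, "ADC21"; held, read pp. 8–9), §3.2, eq. (3.10):
"Existing continuity results [AizDumSid15] permit to extend (3.7) to the infinite volume,
expressed in terms of the weak limits of the random current measures … (3.10)
`⟨σ_A⟩_β⟨σ_B⟩_β / ⟨σ_Aσ_B⟩_β = P^{A∆B,∅}_β[n₁+n₂ ∈ 𝓕_B]`", with footnote 5: "The extension of
the switching lemma to `ℤ^d` is straightforward for `β ≤ β_c` since then `n₁+n₂` does not contain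
infinite paths of positive currents, almost surely under `P^{A,B}_β`. For `β < β_c` this is implied
by the discussion of [Aiz82], and for `β = β_c` it follows from the continuity result of
[AizDumSid15]." The paper gives no further detail; this file supplies the argument.

## The proof

Write `S = A ∆ B`, `P_L = P^{S,∅}_{Λ_L,β}` (`sourcedDoubleCurrentLaw d L β S ∅`), `P = P^{S,∅}_β`
(`sourcedDoubleCurrentLawInf d β S ∅`), `Q_L`, `Q` the same with `S = ∅`.

* *Trivial cases.* `#A` or `#B` odd: `⟨σ_X⟩⁰_β = 0` for `#X` odd (`freeCorr_eq_zero_of_odd_card`)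
  and `𝓕_B = ∅` for `#B` odd (`traceSubcurrentEvent_eq_empty_of_odd_card`, handshake). `β = 0`:
  `⟨σ_A⟩⁰_0 = 𝟙[A = ∅]` and `P^{∅,∅}_{Λ_L,0} = δ_∅` for every `L`, so `P^{∅,∅}_0 = δ_∅`
  (`freeCorr_zero_beta`, `sourcedDoubleCurrentLawInf_zero_beta`).
* *Finite volume* (the tree's `isingCorr_free_box_mul_eq`, ADC21 (3.7)): `⟨σ_A⟩_L⟨σ_B⟩_L =
  ⟨σ_S⟩_L P_L[𝓕_B]`; since `⟨σ_X⟩_L → ⟨σ_X⟩⁰_β` and `⟨σ_S⟩⁰_β > 0` (`#S` even, `β > 0`),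
  `P_L[𝓕_B] → p* = ⟨σ_A⟩⟨σ_B⟩/⟨σ_S⟩`. It remains to show `P[𝓕_B] = p*` — the content of footnote 5.
* *Locality from inside.* `𝓕_B = ⋃_N 𝓕_B^{(N)}` with the local increasing events
  `𝓕_B^{(N)} = {∃ T ⊆ ω inside Λ_N, ∂𝟙_T = B}`; `P[𝓕_B^{(N)}] = lim_L P_L[𝓕_B^{(N)}] ≤ p*`, hence
  `P[𝓕_B] ≤ p*`.
* *Decomposition* (`traceSubcurrentEvent_subset_union`): `𝓕_B ∖ 𝓕_B^{(N)} ⊆ ⋃_{b ∈ B} {b ↔ Λ_Nᶜ}`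
  — restrict a witness `T` to its connected components meeting `B`.
* *Source insertion* (ADS15 §3.2, (3.8)–(3.9), the tree's `Current.tsum_ite_sources_le_of_walk`,
  iterated over a pairing of the sources by walks inside a fixed box, applied to the first current
  of `P^{S,∅} = P^S ⊗ P^∅`): there are `C`, `L₀` with `P_L[E] ≤ C · Q_L[E]` for all `L ≥ L₀` and
  all increasing events `E` (`exists_sourcedDoubleCurrentLaw_real_le_empty`).
* *No percolation of the sourceless double current* (footnote 5 proper). For `0 < β ≤ β_c(d)`,
  `d ≥ 2`: `m*(β) = 0` (definition of `β_c` below it; ADS15 for `d ≥ 3` and Onsager–Yang for `d = 2`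
  at it — tree theorems), so `⟨·⟩⁰_β = ⟨·⟩⁺_β` on spin products, so the cylinder probabilities of
  `Q_L` (free⊗free) and of ADS15's `ℙ_{Λ_L,β}` (plus⊗free) have the same limits (both are the explicit
  polynomials (2.13)–(2.14) in `⟨σ_A⟩⁰ = ⟨σ_A⟩⁺`), hence `Q = ℙ_β`
  (`sourcedDoubleCurrentLawInf_empty_eq_adsDoubleCurrentLawInf`); and `ℙ_β[x ↔ ∞] = 0`
  (ADS15 Thm. 3.1, the tree's `ads_percolatesAt_zero_of_lroTildeSq_holds`, with `M̃_LRO(β) = 0` from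
  `m*(β) = 0` and translation invariance), so `Q[x` connected to distance `M] → 0`.
* *Assembly.* `P_L[𝓕_B] ≤ P_L[𝓕_B^{(N)}] + C ∑_{b∈B} Q_L[b` connected to distance `M]` for `N` large;
  letting `L → ∞` then `M → ∞` gives `p* ≤ P[𝓕_B]`.

## Mathlib status

No random currents in Mathlib. Anchors: `tendsto_measure_iUnion_atTop`,
`tendsto_measure_iInter_atTop`, `le_of_tendsto_of_tendsto`, `Filter.Tendsto.congr'`,
`Finset.eventually_all`, `measureReal_union_le`, `measureReal_biUnion_finset_le`,
`SimpleGraph.Walk.IsPath.length_lt`, `SimpleGraph.Walk.map`, `Summable.tsum_prod`, `tsum_ite_eq`,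
`Finset.even_sum_iff_even_card_odd`, `Sym2.mem_and_mem_iff`, `ext_of_isLocalEvent` (tree); tree:
`isingCorr_free_box_mul_eq`, `traceSubcurrentEvent` (`SourcedDoubleCurrentsSwitching.lean`),
`exists_isSourcedDoubleCurrentLimit`, `sourcedDoubleCurrentLaw_real_localCylinder_eq`,
`sourcedDoubleCurrentLaw_real_congr_lattice` (`SourcedDoubleCurrentsProofs.lean`),
`Current.tsum_ite_sources_le_of_walk` (`CurrentInsertion.lean`), `adsDoubleCurrentLawInf`,
`exitBoxEvent`, `ads_doubleCurrent_limit_exists_holds`, `ads_doubleCurrent_shift_invariant_holds`,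
`ads_percolatesAt_zero_of_lroTildeSq_holds` (`DoubleCurrentsInfinite(Proofs).lean`),
`tendsto_adsDoubleCurrentLaw_localCylinder`, `measureReal_eq_sum_localCylinder`
(`DoubleCurrentsLimit.lean`), `freeCurrentTraceProb`, `tendsto_freeCurrentTraceProb`,
`adsTraceLimit` (`CurrentsTraceLaw.lean`), `freeCorr_eq_plusCorr_of_spontaneousMagnetization_eq_zero`,
`spontaneousMagnetization_eq_zero_of_lt_criticalBeta_holds`,
`spontaneousMagnetization_criticalBeta_eq_zero_holds`, `criticalBeta_two_holds`,
`spontaneousMagnetization_two_criticalBetaTwo_holds`,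
`twoPointFree_tendsto_zero_of_spontaneousMagnetization_eq_zero`,
`lroTildeSq_eq_zero_of_twoPointFree_tendsto_zero`, `Current.weight_zero_beta` (`SourcedCurrentLaw.lean`).
-/

noncomputable section

open MeasureTheory Filter Topology Finset Literature.Probability.Percolation
open scoped symmDiff ENNReal

namespace Literature.Probability.LatticeModels

/-! ### `m*(β) = 0` and `M̃_LRO(β) = 0` for `0 ≤ β ≤ β_c(d)`, `d ≥ 2` -/

section Magnetization

variable {d : ℕ}

/-- For `d ≥ 2` the spontaneous magnetisation vanishes on `[0, β_c(d)]`: below `β_c` by the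
definition of `β_c` (`spontaneousMagnetization_eq_zero_of_lt_criticalBeta_holds`), at `β_c` by the
continuity results `m*(β_c) = 0` (`d ≥ 3`: Aizenman–Duminil-Copin–Sidoravicius 2015; `d = 2`:
Onsager–Yang, `criticalBeta_two_holds`, `spontaneousMagnetization_two_criticalBetaTwo_holds`). [cite: AizenmanDuminilCopinSidoraviciusCMP2015, Thm. 1.2 with Cor. 1.5] -/
theorem spontaneousMagnetization_eq_zero_of_le_criticalBeta_two_le (hd : 2 ≤ d) {β : ℝ} (hβ : 0 ≤ β)
    (hβc : β ≤ criticalBeta d) : spontaneousMagnetization d β = 0 := by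
  rcases lt_or_eq_of_le hβc with hlt | rfl
  · exact spontaneousMagnetization_eq_zero_of_lt_criticalBeta_holds hβ hlt
  · rcases lt_or_eq_of_le hd with hd3 | rfl
    · exact spontaneousMagnetization_criticalBeta_eq_zero_holds (by omega)
    · have h2 : criticalBeta 2 = criticalBetaTwo := criticalBeta_two_holds
      rw [h2]
      exact spontaneousMagnetization_two_criticalBetaTwo_holds

/-- For `d ≥ 2` and `0 ≤ β ≤ β_c(d)`: `M̃_LRO(β)² = 0` (`m*(β) = 0`, so `⟨σ₀σ_x⟩⁰_β → 0`, and the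
Cesàro step ADS15 §1.3 (1.10)). [cite: AizenmanDuminilCopinSidoraviciusCMP2015, §1.3, eq. (1.10)] -/
theorem lroTildeSq_eq_zero_of_le_criticalBeta (hd : 2 ≤ d) {β : ℝ} (hβ : 0 ≤ β)
    (hβc : β ≤ criticalBeta d) : lroTildeSq d β = 0 :=
  lroTildeSq_eq_zero_of_twoPointFree_tendsto_zero (by omega) hβ
    (twoPointFree_tendsto_zero_of_spontaneousMagnetization_eq_zero hβ
      (spontaneousMagnetization_eq_zero_of_le_criticalBeta_two_le hd hβ hβc))

/-- For `d ≥ 2` and `0 ≤ β ≤ β_c(d)` the free and plus states agree on spin products. [cite: AizenmanDuminilCopinSidoraviciusCMP2015, Thm. 1.2] -/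
theorem freeCorr_eq_plusCorr_of_le_criticalBeta (hd : 2 ≤ d) {β : ℝ} (hβ : 0 ≤ β)
    (hβc : β ≤ criticalBeta d) (A : Finset (Site d)) : freeCorr d β 0 A = plusCorr d β 0 A :=
  freeCorr_eq_plusCorr_of_spontaneousMagnetization_eq_zero hβ
    (spontaneousMagnetization_eq_zero_of_le_criticalBeta_two_le hd hβ hβc) A

end Magnetization

/-! ### No percolation of the infinite-volume double current `ℙ_β` at every site -/

section AdsNoPercolation

variable (d : ℕ)

/-- `ℙ_β[x ↔ ∞] = 0` for every site `x`, when `M̃_LRO(β) = 0` (`β > 0`): ADS15 Thm. 3.1 at the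
origin (`ads_percolatesAt_zero_of_lroTildeSq_holds`) and translation invariance R2
(`ads_doubleCurrent_shift_invariant_holds`). [cite: AizenmanDuminilCopinSidoraviciusCMP2015, Thm. 3.1 with Thm. 2.3 (R2)] -/
theorem adsDoubleCurrentLawInf_percolatesAt_eq_zero {β : ℝ} (hβ : 0 < β) (h0 : lroTildeSq d β = 0)
    (x : Site d) : adsDoubleCurrentLawInf d β (percolatesAt x) = 0 := by
  have h00 : adsDoubleCurrentLawInf d β (percolatesAt (0 : Site d)) = 0 :=
    ads_percolatesAt_zero_of_lroTildeSq_holds hβ h0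
  have hpre : (bondShift d (-x)) ⁻¹' (percolatesAt (0 : Site d)) = percolatesAt x := by
    have h := preimage_relabel_shift_percolatesAt (-x) x
    rwa [add_neg_cancel] at h
  rw [← hpre, ← MeasurableEquiv.map_apply, ads_doubleCurrent_shift_invariant_holds hβ (-x)]
  exact h00

/-- **`ℙ_β[x` is connected to distance `N] → 0`** as `N → ∞`, when `M̃_LRO(β) = 0` (`β > 0`):
the local events `exitBoxEvent x N` decrease to a subset of `{x ↔ ∞}`, which is `ℙ_β`-null. [cite: AizenmanDuminilCopinSidoraviciusCMP2015, §3.2, remark after (3.11)] -/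
theorem tendsto_adsDoubleCurrentLawInf_real_exitBoxEvent {β : ℝ} (hβ : 0 < β)
    (h0 : lroTildeSq d β = 0) (x : Site d) :
    Tendsto (fun N : ℕ => (adsDoubleCurrentLawInf d β).real (exitBoxEvent d x N)) atTop (𝓝 0) := by
  have hlim := isAdsLimit_adsDoubleCurrentLawInf d (ads_doubleCurrent_limit_exists_holds hβ)
  set μ := adsDoubleCurrentLawInf d β with hμ
  haveI := hlim.isProbabilityMeasure
  have hBlim : Tendsto (fun N => μ (exitBoxEvent d x N)) atTop (𝓝 (μ (⋂ N, exitBoxEvent d x N))) :=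
    tendsto_measure_iInter_atTop (fun N => (measurableSet_exitBoxEvent d x N).nullMeasurableSet)
      (exitBoxEvent_antitone d x) ⟨0, measure_ne_top μ _⟩
  have hB0 : μ (⋂ N, exitBoxEvent d x N) = 0 :=
    measure_mono_null (iInter_exitBoxEvent_subset_percolatesAt d x)
      (adsDoubleCurrentLawInf_percolatesAt_eq_zero d hβ h0 x)
  rw [hB0] at hBlim
  have h := (ENNReal.tendsto_toReal (ENNReal.zero_ne_top)).comp hBlim
  rw [ENNReal.toReal_zero] at h
  exact h

end AdsNoPercolation

/-! ### Source insertion for pairs of currents (ADS15 (3.8)–(3.9), iterated over a pairing) -/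

section Insertion

variable {V : Type*} [Fintype V] [DecidableEq V] (G : SimpleGraph V) [DecidableRel G.Adj]

/-- `tanh(β/2)⁻¹ ≥ 1`. [folklore] -/
theorem one_le_inv_tanh_half {β : ℝ} (hβ : 0 < β) : 1 ≤ (Real.tanh (β / 2))⁻¹ := by
  have ht : 0 < Real.tanh (β / 2) := Real.tanh_half_pos hβ
  have ht1 : Real.tanh (β / 2) ≤ 1 := by
    rw [Real.tanh_eq_sinh_div_cosh]
    exact (div_le_one (Real.cosh_pos _)).2 (Real.sinh_lt_cosh _).le
  exact (one_le_inv₀ ht).2 ht1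

/-- **Resetting two sources of the first current along a walk** (ADS15 §3.2, (3.8)–(3.9), applied
to the first current of a pair at fixed second current): for `β > 0`, an event `E` of pairs of
currents increasing in the trace of the first current, and a walk of length `k` from `x` to `y`,
`∑ 𝟙{∂n₁=A}𝟙{∂n₂=B} w w 𝟙_E ≤ tanh(β/2)^{-k} ∑ 𝟙{∂n₁=A∆{x}∆{y}}𝟙{∂n₂=B} w w 𝟙_E`. [cite: AizenmanDuminilCopinSidoraviciusCMP2015, §3.2, eqs. (3.8)–(3.9)] -/
theorem tsum_pairWeight_mul_indicator_le_of_walk {β : ℝ} (hβ : 0 < β) (A B : Finset V)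
    {E : Set (Current G × Current G)}
    (hE : ∀ n₁ n₁' n₂ : Current G, n₁.traced ⊆ n₁'.traced → (n₁, n₂) ∈ E → (n₁', n₂) ∈ E)
    {x y : V} (p : G.Walk x y) :
    ∑' q : Current G × Current G, pairWeight G β A B q * E.indicator 1 q ≤
      (Real.tanh (β / 2))⁻¹ ^ p.length *
        ∑' q : Current G × Current G, pairWeight G β (A ∆ ({x} ∆ {y})) B q * E.indicator 1 q := by
  classical
  set g : Current G → Current G → ℝ := fun n₁ n₂ =>
    (if n₂.sources = B then n₂.weight β else 0) * E.indicator 1 (n₁, n₂) with hg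
  set Gf : Current G → ℝ := fun n₁ => ∑' n₂, g n₁ n₂ with hGf
  set ZB := currentSum G β B with hZB
  have hind01 : ∀ q : Current G × Current G, 0 ≤ E.indicator (1 : Current G × Current G → ℝ) q ∧
      E.indicator (1 : Current G × Current G → ℝ) q ≤ 1 := by
    intro q
    by_cases hq : q ∈ E
    · rw [Set.indicator_of_mem hq, Pi.one_apply]; exact ⟨zero_le_one, le_rfl⟩
    · rw [Set.indicator_of_notMem hq]; exact ⟨le_rfl, zero_le_one⟩
  have hw0 : ∀ n₂ : Current G, 0 ≤ (if n₂.sources = B then n₂.weight β else 0) := fun n₂ => by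
    split_ifs
    · exact Current.weight_nonneg hβ.le _
    · exact le_rfl
  have hg_nonneg : ∀ n₁ n₂, 0 ≤ g n₁ n₂ := fun n₁ n₂ => mul_nonneg (hw0 n₂) (hind01 _).1
  have hg_le : ∀ n₁ n₂, g n₁ n₂ ≤ (if n₂.sources = B then n₂.weight β else 0) := fun n₁ n₂ =>
    mul_le_of_le_one_right (hw0 n₂) (hind01 _).2
  have hg_summable : ∀ n₁, Summable (g n₁) := fun n₁ =>
    Summable.of_nonneg_of_le (hg_nonneg n₁) (hg_le n₁) (summable_currentWeight_indicator_holds G β B)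
  have hGf_nonneg : ∀ n₁, 0 ≤ Gf n₁ := fun n₁ => tsum_nonneg (hg_nonneg n₁)
  have hGf_le : ∀ n₁, Gf n₁ ≤ ZB := fun n₁ =>
    Summable.tsum_le_tsum (hg_le n₁) (hg_summable n₁) (summable_currentWeight_indicator_holds G β B)
  have hGf_mono : ∀ n₁ n₁' : Current G, n₁.traced ⊆ n₁'.traced → Gf n₁ ≤ Gf n₁' := by
    intro n₁ n₁' h
    refine Summable.tsum_le_tsum (fun n₂ => ?_) (hg_summable n₁) (hg_summable n₁')
    refine mul_le_mul_of_nonneg_left ?_ (hw0 n₂)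
    by_cases h1 : (n₁, n₂) ∈ E
    · rw [Set.indicator_of_mem h1, Set.indicator_of_mem (hE _ _ _ h h1)]
      exact le_rfl
    · rw [Set.indicator_of_notMem h1]; exact (hind01 _).1
  -- both sides as iterated sums
  have hiter : ∀ A₀ : Finset V, ∑' q : Current G × Current G, pairWeight G β A₀ B q * E.indicator 1 q =
      ∑' n₁ : Current G, (if n₁.sources = A₀ then n₁.weight β * Gf n₁ else 0) := by
    intro A₀
    have hsum : Summable fun q : Current G × Current G => pairWeight G β A₀ B q * E.indicator 1 q :=
      summable_pairWeight_mul G β A₀ B (C := 1) fun q => by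
        rw [Real.norm_eq_abs, abs_of_nonneg (hind01 q).1]; exact (hind01 q).2
    rw [hsum.tsum_prod]
    refine tsum_congr fun n₁ => ?_
    by_cases hA : n₁.sources = A₀
    · rw [if_pos hA, hGf]
      simp only
      rw [← tsum_mul_left]
      refine tsum_congr fun n₂ => ?_
      simp only [pairWeight, hg, hA, true_and]
      split_ifs <;> ring
    · rw [if_neg hA]
      have : (fun n₂ : Current G => pairWeight G β A₀ B (n₁, n₂) * E.indicator 1 (n₁, n₂)) = fun _ => 0 := by
        funext n₂
        simp only [pairWeight, hA, false_and, if_false, zero_mul]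
      rw [this, tsum_zero]
  rw [hiter A, hiter (A ∆ ({x} ∆ {y}))]
  by_cases hZ : ZB = 0
  · have hG0 : ∀ n₁, Gf n₁ = 0 := fun n₁ => le_antisymm (hZ ▸ hGf_le n₁) (hGf_nonneg n₁)
    simp only [hG0, mul_zero, ite_self, tsum_zero, mul_zero, le_refl]
  · have hZpos : 0 < ZB := lt_of_le_of_ne (currentSum_nonneg G hβ.le B) (Ne.symm hZ)
    have key := Current.tsum_ite_sources_le_of_walk hβ (Finset.univ : Finset V) (fun n₁ => Gf n₁ / ZB)
      (fun n => div_nonneg (hGf_nonneg n) hZpos.le) (fun n => (div_le_one hZpos).2 (hGf_le n))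
      (fun n n' h => div_le_div_of_nonneg_right (hGf_mono n n' h) hZpos.le) p A
    simp only [Finset.inter_univ] at key
    have hscale : ∀ A₀ : Finset V,
        ∑' n₁ : Current G, (if n₁.sources = A₀ then n₁.weight β * (Gf n₁ / ZB) else 0) =
        (∑' n₁ : Current G, (if n₁.sources = A₀ then n₁.weight β * Gf n₁ else 0)) / ZB := by
      intro A₀
      rw [← tsum_div_const]
      refine tsum_congr fun n₁ => ?_
      split_ifs
      · ring
      · simp
    rw [hscale, hscale, ← mul_div_assoc] at key
    exact (div_le_div_iff_of_pos_right hZpos).1 key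

/-- Pair-weight series with indicators are nonnegative (`β ≥ 0`). [folklore] -/
theorem tsum_pairWeight_mul_indicator_nonneg {β : ℝ} (hβ : 0 ≤ β) (A B : Finset V)
    (E : Set (Current G × Current G)) :
    0 ≤ ∑' q : Current G × Current G, pairWeight G β A B q * E.indicator 1 q :=
  tsum_nonneg fun q => mul_nonneg (pairWeight_nonneg G hβ A B q)
    (Set.indicator_nonneg (fun _ _ => zero_le_one) q)

/-- **Resetting all the sources of the first current** (ADS15 (3.8)–(3.9) iterated over a pairing of
`A`): if any two vertices of `K` are joined by a walk of length `≤ M`, then for `A ⊆ K` with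
`#A = 2k` and an event `E` increasing in the trace of the first current,
`∑ 𝟙{∂n₁=A}𝟙{∂n₂=B} w w 𝟙_E ≤ (tanh(β/2)^{-M})^k ∑ 𝟙{∂n₁=∅}𝟙{∂n₂=B} w w 𝟙_E`. [cite: AizenmanDuminilCopinSidoraviciusCMP2015, §3.2, eqs. (3.8)–(3.9)] -/
theorem tsum_pairWeight_mul_indicator_le_of_card_eq {β : ℝ} (hβ : 0 < β) (B : Finset V)
    {E : Set (Current G × Current G)}
    (hE : ∀ n₁ n₁' n₂ : Current G, n₁.traced ⊆ n₁'.traced → (n₁, n₂) ∈ E → (n₁', n₂) ∈ E)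
    (K : Finset V) (M : ℕ) (hK : ∀ x ∈ K, ∀ y ∈ K, ∃ p : G.Walk x y, p.length ≤ M) :
    ∀ (k : ℕ) (A : Finset V), A ⊆ K → #A = 2 * k →
      ∑' q : Current G × Current G, pairWeight G β A B q * E.indicator 1 q ≤
        ((Real.tanh (β / 2))⁻¹ ^ M) ^ k *
          ∑' q : Current G × Current G, pairWeight G β ∅ B q * E.indicator 1 q := by
  set c := (Real.tanh (β / 2))⁻¹ with hc
  have hc1 : 1 ≤ c := one_le_inv_tanh_half hβ
  intro k
  induction k with
  | zero =>
    intro A _ hA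
    rw [mul_zero, Finset.card_eq_zero] at hA
    subst hA
    simp
  | succ k ih =>
    intro A hAK hA
    have hne : A.Nonempty := Finset.card_pos.1 (by omega)
    obtain ⟨x, hx⟩ := hne
    have hne' : (A.erase x).Nonempty := Finset.card_pos.1 (by rw [Finset.card_erase_of_mem hx]; omega)
    obtain ⟨y, hy⟩ := hne'
    obtain ⟨hyx, hyA⟩ := Finset.mem_erase.1 hy
    obtain ⟨p, hp⟩ := hK x (hAK hx) y (hAK hyA)
    have h1 := tsum_pairWeight_mul_indicator_le_of_walk G hβ A B hE p
    have hA' : A ∆ ({x} ∆ {y}) = (A.erase x).erase y := by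
      ext v
      simp only [Finset.mem_symmDiff, Finset.mem_singleton, Finset.mem_erase]
      by_cases hvx : v = x
      · subst hvx; simp [hx, hyx.symm]
      · by_cases hvy : v = y
        · subst hvy; simp [hyA, hvx]
        · simp [hvx, hvy]
    have hcard : #((A.erase x).erase y) = 2 * k := by
      rw [Finset.card_erase_of_mem hy, Finset.card_erase_of_mem hx, hA]; omega
    have h2 := ih ((A.erase x).erase y)
      ((Finset.erase_subset _ _).trans ((Finset.erase_subset _ _).trans hAK)) hcard
    rw [hA'] at h1
    have hX := tsum_pairWeight_mul_indicator_nonneg G hβ.le ((A.erase x).erase y) B E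
    have hY := tsum_pairWeight_mul_indicator_nonneg G hβ.le ∅ B E
    calc ∑' q : Current G × Current G, pairWeight G β A B q * E.indicator 1 q
        ≤ c ^ p.length * ∑' q : Current G × Current G,
            pairWeight G β ((A.erase x).erase y) B q * E.indicator 1 q := h1
      _ ≤ c ^ M * ∑' q : Current G × Current G,
            pairWeight G β ((A.erase x).erase y) B q * E.indicator 1 q :=
          mul_le_mul_of_nonneg_right (pow_le_pow_right₀ hc1 hp) hX
      _ ≤ c ^ M * ((c ^ M) ^ k * ∑' q : Current G × Current G, pairWeight G β ∅ B q * E.indicator 1 q) :=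
          mul_le_mul_of_nonneg_left h2 (by positivity)
      _ = (c ^ M) ^ (k + 1) * ∑' q : Current G × Current G, pairWeight G β ∅ B q * E.indicator 1 q := by
          ring

end Insertion

/-! ### Source insertion for the sourced double currents of the boxes of `ℤ^d` -/

section BoxInsertion

variable (d : ℕ)

/-- Any two vertices of `Λ_{L₀}` are joined, in every free box graph `freeBoxGraph d L` with
`L ≥ L₀`, by a walk of length at most `|Λ_{L₀+1}|` (a path of `freeBoxGraph d L₀`, included in
`freeBoxGraph d L`). [folklore] -/
theorem exists_walk_freeBoxGraph_length_le (L₀ : ℕ) :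
    ∃ M : ℕ, ∀ L, L₀ ≤ L → ∀ x y : BoxVertex d L, (x : Site d) ∈ box d L₀ → (y : Site d) ∈ box d L₀ →
      ∃ p : (freeBoxGraph d L).Walk x y, p.length ≤ M := by
  refine ⟨Fintype.card (BoxVertex d L₀), fun L hL x y hx hy => ?_⟩
  set x₀ : BoxVertex d L₀ := ⟨x, box_subset_box_succ d L₀ hx⟩
  set y₀ : BoxVertex d L₀ := ⟨y, box_subset_box_succ d L₀ hy⟩
  obtain ⟨w₀⟩ := freeBoxGraph_reachable d (x := x₀) (y := y₀) hx hy
  have hsub : box d (L₀ + 1) ⊆ box d (L + 1) := box_mono d (by omega)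
  let φ : freeBoxGraph d L₀ →g freeBoxGraph d L :=
    { toFun := fun v => ⟨v.1, hsub v.2⟩
      map_rel' := fun {a b} h => ⟨h.1, box_mono d hL h.2.1, box_mono d hL h.2.2⟩ }
  refine ⟨(w₀.toPath.1.map φ).copy rfl rfl, ?_⟩
  rw [SimpleGraph.Walk.length_copy, SimpleGraph.Walk.length_map]
  exact w₀.toPath.2.length_lt.le

/-- **Source insertion for `P^{S,∅}_{Λ_L,β}` against `P^{∅,∅}_{Λ_L,β}`, uniformly in the volume**
(ADS15 §3.2, (3.8)–(3.9), applied to the first current of ADC21's `P^{S,∅}_{Λ,β} = P^S ⊗ P^∅`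
along a pairing of `S` by walks inside a fixed box): for `β > 0` and `#S` even there are `C` and
`L₀` such that for all `L ≥ L₀` and every increasing measurable event `E` of bond configurations,
`P^{S,∅}_{Λ_L,β}[E] ≤ C · P^{∅,∅}_{Λ_L,β}[E]`
(`C = tanh(β/2)^{-M #S/2} / ⟨σ_S⟩⁰_{Λ_{L₀}}`). [cite: AizenmanDuminilCopinSidoraviciusCMP2015, §3.2, eqs. (3.8)–(3.9)] [cite: AizenmanDuminilCopinAnnals2021, §3.1] -/
theorem exists_sourcedDoubleCurrentLaw_real_le_empty {β : ℝ} (hβ : 0 < β) {S : Finset (Site d)}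
    (hS : Even #S) :
    ∃ C : ℝ, ∃ L₀ : ℕ, 0 ≤ C ∧ ∀ L, L₀ ≤ L → ∀ E : Set (BondConfig (Site d)), MeasurableSet E →
      IsUpperSet E →
      (sourcedDoubleCurrentLaw d L β S ∅).real E ≤ C * (sourcedDoubleCurrentLaw d L β ∅ ∅).real E := by
  classical
  obtain ⟨L₀, hL₀⟩ := exists_forall_subset_box d S
  obtain ⟨M, hM⟩ := exists_walk_freeBoxGraph_length_le d L₀
  obtain ⟨k, hk⟩ := hS
  set c := (Real.tanh (β / 2))⁻¹ with hc
  set s₀ := isingCorr (zdGraph d) (box d L₀) β 0 .free S with hs₀_def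
  have hs₀ : 0 < s₀ := isingCorr_free_box_pos d hβ (hL₀ L₀ le_rfl) ⟨k, hk⟩
  have hcMk : 0 ≤ (c ^ M) ^ k := pow_nonneg (pow_nonneg (inv_nonneg.2 (Real.tanh_half_pos hβ).le) _) _
  refine ⟨(c ^ M) ^ k / s₀, L₀, div_nonneg hcMk hs₀.le, fun L hL E hEm hEup => ?_⟩
  have hSL : S ⊆ box d L := hL₀ L hL
  set G := freeBoxGraph d L with hG
  set S' := boxSources d L S with hS'
  have hZS : 0 < currentSum G β S' := currentSum_boxSources_pos d hβ hSL ⟨k, hk⟩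
  have hZ0 : 0 < currentSum G β (∅ : Finset (BoxVertex d L)) := currentSum_empty_pos' G β
  -- the event read on pairs of currents; increasing in the trace of the first current
  set E' : Set (Current G × Current G) := sourcedTrace d L ⁻¹' E with hE'
  have hE'meas : MeasurableSet E' := (Set.to_countable _).measurableSet
  have hE'up : ∀ n₁ n₁' n₂ : Current G, n₁.traced ⊆ n₁'.traced → (n₁, n₂) ∈ E' → (n₁', n₂) ∈ E' := by
    intro n₁ n₁' n₂ h h1
    rw [hE', Set.mem_preimage] at h1 ⊢
    refine hEup ?_ h1
    change sourcedTrace d L (n₁, n₂) ⊆ sourcedTrace d L (n₁', n₂)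
    rw [sourcedTrace_eq_union, sourcedTrace_eq_union]
    exact Set.union_subset_union_left _ (liftBonds_mono d h)
  -- the two probabilities as series
  have hPS : (sourcedDoubleCurrentLaw d L β S ∅).real E =
      (∑' q : Current G × Current G, pairWeight G β S' ∅ q * E'.indicator 1 q) /
        (currentSum G β S' * currentSum G β ∅) := by
    rw [eq_div_iff (mul_pos hZS hZ0).ne', measureReal_def, sourcedDoubleCurrentLaw_apply L β S ∅ hEm,
      ← measureReal_def, boxSources_empty]
    exact doubleCurrentMeasure_real_mul G β hβ.le S' ∅ hE'meas (mul_pos hZS hZ0).ne'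
  have hP0 : (sourcedDoubleCurrentLaw d L β ∅ ∅).real E =
      (∑' q : Current G × Current G, pairWeight G β ∅ ∅ q * E'.indicator 1 q) /
        (currentSum G β ∅ * currentSum G β ∅) := by
    rw [eq_div_iff (mul_pos hZ0 hZ0).ne', measureReal_def, sourcedDoubleCurrentLaw_apply L β ∅ ∅ hEm,
      ← measureReal_def, boxSources_empty]
    exact doubleCurrentMeasure_real_mul G β hβ.le ∅ ∅ hE'meas (mul_pos hZ0 hZ0).ne'
  -- walks pairing the sources inside `Λ_{L₀}`
  have hK : ∀ x ∈ boxSources d L (box d L₀), ∀ y ∈ boxSources d L (box d L₀),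
      ∃ p : G.Walk x y, p.length ≤ M := fun x hx y hy =>
    hM L hL x y (mem_boxSources_iff.1 hx) (mem_boxSources_iff.1 hy)
  have hS'K : S' ⊆ boxSources d L (box d L₀) := fun v hv =>
    mem_boxSources_iff.2 (hL₀ L₀ le_rfl (mem_boxSources_iff.1 hv))
  have hcardS' : #S' = 2 * k := by rw [hS', card_boxSources hSL, hk]; ring
  have key := tsum_pairWeight_mul_indicator_le_of_card_eq G hβ ∅ hE'up _ M hK k S' hS'K hcardS'
  -- `⟨σ_S⟩⁰_{Λ_L} = Z_{S'}/Z_∅ ≥ ⟨σ_S⟩⁰_{Λ_{L₀}} > 0`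
  have hcorr : isingCorr (zdGraph d) (box d L) β 0 .free S = currentSum G β S' / currentSum G β ∅ := by
    have h1 := isingCorr_free_box_eq d L β (boxSources_subset_boxCore hSL)
    rw [map_boxSources hSL] at h1
    rw [h1, plusCurrentSum_freeBoxGraph_eq_currentSum, plusCurrentSum_freeBoxGraph_eq_currentSum]
  have hmono : s₀ ≤ isingCorr (zdGraph d) (box d L) β 0 .free S := by
    have hm := monotone_isingCorr_free_box (d := d) hβ.le le_rfl (A := S) (L₀ := L₀) hL₀
    have h := hm (Nat.zero_le (L - L₀))
    simp only [zero_add, Nat.sub_add_cancel hL] at h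
    exact h
  rw [hPS, hP0]
  have hY := tsum_pairWeight_mul_indicator_nonneg G hβ.le ∅ ∅ E'
  calc (∑' q : Current G × Current G, pairWeight G β S' ∅ q * E'.indicator 1 q) /
        (currentSum G β S' * currentSum G β ∅)
      ≤ ((c ^ M) ^ k * ∑' q : Current G × Current G, pairWeight G β ∅ ∅ q * E'.indicator 1 q) /
          (currentSum G β S' * currentSum G β ∅) :=
        div_le_div_of_nonneg_right key (mul_pos hZS hZ0).le
    _ = (c ^ M) ^ k / (currentSum G β S' / currentSum G β ∅) *
          ((∑' q : Current G × Current G, pairWeight G β ∅ ∅ q * E'.indicator 1 q) /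
            (currentSum G β ∅ * currentSum G β ∅)) := by
        field_simp
    _ ≤ (c ^ M) ^ k / s₀ *
          ((∑' q : Current G × Current G, pairWeight G β ∅ ∅ q * E'.indicator 1 q) /
            (currentSum G β ∅ * currentSum G β ∅)) := by
        refine mul_le_mul_of_nonneg_right ?_ (div_nonneg hY (mul_pos hZ0 hZ0).le)
        rw [← hcorr]
        exact div_le_div_of_nonneg_left hcMk hs₀ hmono

end BoxInsertion

/-! ### The sourceless free⊗free limit is ADS15's `ℙ_β` when the free and plus states agree -/

section Identification

variable (d : ℕ)

open Classical in
/-- The one-current factor with no sources is the free trace probability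
`P̂⁰_{Λ_L,β}[n̂ ∩ F = U₁]`. [folklore] -/
theorem sourcedFactor_empty_eq_freeCurrentTraceProb (L : ℕ) (β : ℝ) (F U₁ : Finset (Sym2 (Site d))) :
    (∑' n : Current (freeBoxGraph d L),
        if n.sources = boxSources d L ∅ ∧ ∀ e ∈ F, (e ∈ U₁ ↔ e ∈ liftBonds d L n.traced)
        then n.weight β else 0) / currentSum (freeBoxGraph d L) β (boxSources d L ∅) =
      freeCurrentTraceProb d L β F U₁ := by
  unfold freeCurrentTraceProb
  rw [plusCurrentSum_freeBoxGraph_eq_currentSum, boxSources_empty]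
  refine congrArg (fun t : ℝ => t / currentSum (freeBoxGraph d L) β ∅) ?_
  exact tsum_congr fun n =>
    if_congr (by rw [Finset.inter_eq_left.2 (sources_subset_boxCore d n)]) rfl rfl

open Classical in
/-- **`P^{∅,∅}_{Λ_L,β}` on cylinders**: `P^{∅,∅}_{Λ_L,β}[ω ∩ F = U] =
∑_{U₁ ∪ U₂ = U} P̂⁰_{Λ_L,β}[n̂₁ ∩ F = U₁] P̂⁰_{Λ_L,β}[n̂₂ ∩ F = U₂]` (`β ≥ 0`, `U ⊆ F`). [cite: AizenmanDuminilCopinAnnals2021, §3.1] -/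
theorem sourcedDoubleCurrentLaw_empty_real_localCylinder_eq (L : ℕ) {β : ℝ} (hβ : 0 ≤ β)
    {F U : Finset (Sym2 (Site d))} (hUF : U ⊆ F) :
    (sourcedDoubleCurrentLaw d L β ∅ ∅).real (localCylinder (↑F : Set (Sym2 (Site d))) ↑U) =
      ∑ U₁ ∈ U.powerset, ∑ U₂ ∈ U.powerset, if U₁ ∪ U₂ = U then
        freeCurrentTraceProb d L β F U₁ * freeCurrentTraceProb d L β F U₂ else 0 := by
  have hZ : currentSum (freeBoxGraph d L) β (boxSources d L ∅) ≠ 0 := by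
    rw [boxSources_empty]; exact (currentSum_empty_pos' _ β).ne'
  rw [sourcedDoubleCurrentLaw_real_localCylinder_eq d L hβ hZ hZ hUF]
  refine Finset.sum_congr rfl fun U₁ _ => Finset.sum_congr rfl fun U₂ _ => ?_
  split_ifs
  · rw [sourcedFactor_empty_eq_freeCurrentTraceProb, sourcedFactor_empty_eq_freeCurrentTraceProb]
  · rfl

/-- If `⟨σ_A⟩⁰_β = ⟨σ_A⟩⁺_β` for all `A`, the free and plus avoidance limits coincide. [cite: AizenmanDuminilCopinSidoraviciusCMP2015, Thm. 2.3 (R1), proof] -/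
theorem freeCurrentAvoidLimit_eq_plusCurrentAvoidLimit {β : ℝ}
    (hcorr : ∀ A : Finset (Site d), freeCorr d β 0 A = plusCorr d β 0 A) (T : Finset (Sym2 (Site d))) :
    freeCurrentAvoidLimit d β T = plusCurrentAvoidLimit d β T := by
  unfold freeCurrentAvoidLimit plusCurrentAvoidLimit
  simp only [hcorr]

/-- If `⟨σ_A⟩⁰_β = ⟨σ_A⟩⁺_β` for all `A`, the free and plus trace limits coincide. [cite: AizenmanDuminilCopinSidoraviciusCMP2015, Thm. 2.3 (R1), proof] -/
theorem freeCurrentTraceLimit_eq_plusCurrentTraceLimit {β : ℝ}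
    (hcorr : ∀ A : Finset (Site d), freeCorr d β 0 A = plusCorr d β 0 A) (F U : Finset (Sym2 (Site d))) :
    freeCurrentTraceLimit d β F U = plusCurrentTraceLimit d β F U := by
  unfold freeCurrentTraceLimit plusCurrentTraceLimit
  simp only [freeCurrentAvoidLimit_eq_plusCurrentAvoidLimit d hcorr]

/-- **Convergence of `P^{∅,∅}_{Λ_L,β}` on lattice cylinders to ADS15's limit** when the free and plus
states agree: `P^{∅,∅}_{Λ_L,β}[ω ∩ F = U] → adsTraceLimit d β F U`. [cite: AizenmanDuminilCopinSidoraviciusCMP2015, Thm. 2.3 (R1) and §2.3] -/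
theorem tendsto_sourcedDoubleCurrentLaw_empty_localCylinder_lattice {β : ℝ} (hβ : 0 ≤ β)
    (hcorr : ∀ A : Finset (Site d), freeCorr d β 0 A = plusCorr d β 0 A) {F U : Finset (Sym2 (Site d))}
    (hF : ↑F ⊆ (zdGraph d).edgeSet) (hUF : U ⊆ F) :
    Tendsto (fun L : ℕ => (sourcedDoubleCurrentLaw d L β ∅ ∅).real (localCylinder (↑F : Set (Sym2 (Site d))) ↑U))
      atTop (𝓝 (adsTraceLimit d β F U)) := by
  classical
  unfold adsTraceLimit
  simp_rw [sourcedDoubleCurrentLaw_empty_real_localCylinder_eq d _ hβ hUF,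
    ← freeCurrentTraceLimit_eq_plusCurrentTraceLimit d hcorr]
  refine tendsto_finsetSum _ fun U₁ hU₁ => tendsto_finsetSum _ fun U₂ hU₂ => ?_
  rw [Finset.mem_powerset] at hU₁ hU₂
  by_cases h : U₁ ∪ U₂ = U
  · simp only [if_pos h]
    exact (tendsto_freeCurrentTraceProb d hβ hF (hU₁.trans hUF)).mul
      (tendsto_freeCurrentTraceProb d hβ hF (hU₂.trans hUF))
  · simp only [if_neg h]
    exact tendsto_const_nhds

/-- **Convergence of `P^{∅,∅}_{Λ_L,β}` on every cylinder to ADS15's limit** when the free and plus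
states agree (non-lattice pairs are never open). [cite: AizenmanDuminilCopinSidoraviciusCMP2015, Thm. 2.3 (R1) and §2.3] -/
theorem tendsto_sourcedDoubleCurrentLaw_empty_localCylinder {β : ℝ} (hβ : 0 ≤ β)
    (hcorr : ∀ A : Finset (Site d), freeCorr d β 0 A = plusCorr d β 0 A) {F U : Finset (Sym2 (Site d))}
    (hUF : U ⊆ F) :
    Tendsto (fun L : ℕ => (sourcedDoubleCurrentLaw d L β ∅ ∅).real (localCylinder (↑F : Set (Sym2 (Site d))) ↑U))
      atTop (𝓝 (adsTraceLimitGen d β F U)) := by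
  classical
  unfold adsTraceLimitGen
  by_cases hgood : ∀ e ∈ F, e ∉ (zdGraph d).edgeSet → e ∉ U
  · rw [if_pos hgood]
    set F' := F.filter (· ∈ (zdGraph d).edgeSet) with hF'
    set U' := U.filter (· ∈ (zdGraph d).edgeSet) with hU'
    have hF'E : (↑F' : Set (Sym2 (Site d))) ⊆ (zdGraph d).edgeSet := fun e he =>
      (Finset.mem_filter.1 (Finset.mem_coe.1 he)).2
    have hU'F' : U' ⊆ F' := Finset.filter_subset_filter _ hUF
    have heq : ∀ L, (sourcedDoubleCurrentLaw d L β ∅ ∅).real (localCylinder (↑F : Set (Sym2 (Site d))) ↑U) =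
        (sourcedDoubleCurrentLaw d L β ∅ ∅).real (localCylinder (↑F' : Set (Sym2 (Site d))) ↑U') := by
      intro L
      refine sourcedDoubleCurrentLaw_real_congr_lattice d L β ∅ ∅ (measurableSet_localCylinder_coe d F ↑U)
        (measurableSet_localCylinder_coe d F' ↑U') fun ω hω => ?_
      rw [mem_localCylinder_coe_iff, mem_localCylinder_coe_iff]
      constructor
      · intro h e he
        rw [hF', Finset.mem_filter] at he
        rw [hU', Finset.mem_filter, h e he.1]
        exact ⟨fun h' => h'.1, fun h' => ⟨h', he.2⟩⟩
      · intro h e he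
        by_cases heE : e ∈ (zdGraph d).edgeSet
        · have h1 := h e (by rw [hF', Finset.mem_filter]; exact ⟨he, heE⟩)
          rw [hU', Finset.mem_filter] at h1
          rw [← h1]
          exact ⟨fun h' => ⟨h', heE⟩, fun h' => h'.1⟩
        · exact ⟨fun heU => absurd heU (hgood e he heE), fun heω => absurd (hω heω) heE⟩
    simp_rw [heq]
    exact tendsto_sourcedDoubleCurrentLaw_empty_localCylinder_lattice d hβ hcorr hF'E hU'F'
  · rw [if_neg hgood]
    push Not at hgood
    obtain ⟨e, heF, heE, heU⟩ := hgood
    have heq : ∀ L, (sourcedDoubleCurrentLaw d L β ∅ ∅).real (localCylinder (↑F : Set (Sym2 (Site d))) ↑U) = 0 := by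
      intro L
      rw [← measureReal_empty (μ := sourcedDoubleCurrentLaw d L β ∅ ∅)]
      refine sourcedDoubleCurrentLaw_real_congr_lattice d L β ∅ ∅ (measurableSet_localCylinder_coe d F ↑U)
        MeasurableSet.empty fun ω hω => ?_
      rw [mem_localCylinder_coe_iff, Set.mem_empty_iff_false, iff_false]
      intro h
      exact heE (hω ((h e heF).1 heU))
    simp_rw [heq]
    exact tendsto_const_nhds

/-- **The infinite-volume sourceless free⊗free double current is ADS15's `ℙ_β`** when the free and
plus states agree on spin products (`β > 0`): both are local limits, their cylinder probabilities
are the same functions of `⟨σ_A⟩⁰_β = ⟨σ_A⟩⁺_β` (ADS15 (2.13)–(2.14)), and local events are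
finite disjoint unions of cylinders. [cite: AizenmanDuminilCopinSidoraviciusCMP2015, Thm. 2.3 (R1) and §2.3] -/
theorem sourcedDoubleCurrentLawInf_empty_eq_adsDoubleCurrentLawInf {β : ℝ} (hβ : 0 < β)
    (hcorr : ∀ A : Finset (Site d), freeCorr d β 0 A = plusCorr d β 0 A) :
    sourcedDoubleCurrentLawInf d β ∅ ∅ = adsDoubleCurrentLawInf d β := by
  classical
  have hQ := isSourcedDoubleCurrentLimit_lawInf
    (exists_isSourcedDoubleCurrentLimit d hβ (A := ∅) (B := ∅) (by simp) (by simp))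
  have hP := isAdsLimit_adsDoubleCurrentLawInf d (ads_doubleCurrent_limit_exists_holds hβ)
  set Q := sourcedDoubleCurrentLawInf d β ∅ ∅ with hQdef
  set P := adsDoubleCurrentLawInf d β with hPdef
  haveI := hQ.isProbabilityMeasure
  haveI := hP.isProbabilityMeasure
  have hcyl : ∀ F U : Finset (Sym2 (Site d)), U ⊆ F →
      Q.real (localCylinder (↑F : Set (Sym2 (Site d))) ↑U) = P.real (localCylinder (↑F : Set (Sym2 (Site d))) ↑U) := by
    intro F U hUF
    have h1 := hQ.tendsto_local _ (isLocalEvent_localCylinder F (↑U : Set (Sym2 (Site d))))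
    have h2 := hP.tendsto_local _ (isLocalEvent_localCylinder F (↑U : Set (Sym2 (Site d))))
    rw [tendsto_nhds_unique h1 (tendsto_sourcedDoubleCurrentLaw_empty_localCylinder d hβ.le hcorr hUF),
      tendsto_nhds_unique h2 (tendsto_adsDoubleCurrentLaw_localCylinder d hβ.le hUF)]
  refine ext_of_isLocalEvent fun A hA => ?_
  obtain ⟨F, hF⟩ := hA
  have hreal : Q.real A = P.real A := by
    rw [measureReal_eq_sum_localCylinder d Q hF, measureReal_eq_sum_localCylinder d P hF]
    exact Finset.sum_congr rfl fun U hU => hcyl F U (Finset.mem_powerset.1 (Finset.mem_filter.1 hU).1)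
  rw [measureReal_def, measureReal_def] at hreal
  exact (ENNReal.toReal_eq_toReal_iff' (measure_ne_top Q A) (measure_ne_top P A)).1 hreal

/-- **No percolation of the sourceless free⊗free double current for `0 < β ≤ β_c(d)`, `d ≥ 2`**:
`P^{∅,∅}_β[x` is connected to distance `N] → 0` (footnote 5 of ADC21 §3.2: "`n₁+n₂` does not
contain infinite paths … [Aiz82] for `β < β_c` … [AizDumSid15] for `β = β_c`"; here from
`m*(β) = 0`, the identification with ADS15's `ℙ_β` and ADS15 Thm. 3.1). [cite: AizenmanDuminilCopinAnnals2021, §3.2, footnote 5] [cite: AizenmanDuminilCopinSidoraviciusCMP2015, Thm. 3.1] -/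
theorem tendsto_sourcedDoubleCurrentLawInf_empty_real_exitBoxEvent (hd : 2 ≤ d) {β : ℝ} (hβ : 0 < β)
    (hβc : β ≤ criticalBeta d) (x : Site d) :
    Tendsto (fun N : ℕ => (sourcedDoubleCurrentLawInf d β ∅ ∅).real (exitBoxEvent d x N)) atTop (𝓝 0) := by
  rw [sourcedDoubleCurrentLawInf_empty_eq_adsDoubleCurrentLawInf d hβ
    (freeCorr_eq_plusCorr_of_le_criticalBeta hd hβ.le hβc)]
  exact tendsto_adsDoubleCurrentLawInf_real_exitBoxEvent d hβ
    (lroTildeSq_eq_zero_of_le_criticalBeta hd hβ.le hβc) x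

end Identification

/-! ### The case `β = 0`: `P^{∅,∅}_{Λ_L,0} = δ_∅` and `⟨σ_A⟩⁰_{0} = 𝟙[A = ∅]` -/

section BetaZero

variable {V : Type*} [Fintype V] [DecidableEq V] (G : SimpleGraph V) [DecidableRel G.Adj]

/-- At `β = 0`, `∑_{∂n = A} w_0(n) = 𝟙[A = ∅]` (the tree's `Current.weight_zero_beta`:
`w_0(n) = 𝟙[n = 0]`). [folklore] -/
theorem currentSum_zero_beta (A : Finset V) : currentSum G 0 A = if A = ∅ then 1 else 0 := by
  classical
  unfold currentSum
  have hfun : (fun n : Current G => if n.sources = A then n.weight 0 else 0) =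
      fun n => if n = 0 then (if A = ∅ then 1 else 0) else 0 := by
    funext n
    rw [Current.weight_zero_beta]
    by_cases hn : n = 0
    · subst hn
      simp only [Current.sources_zero, if_true]
      by_cases hA : A = ∅
      · simp [hA]
      · rw [if_neg (Ne.symm hA), if_neg hA]
    · simp [hn]
  rw [hfun, tsum_ite_eq]

variable (d : ℕ)

/-- The zero currents have empty lifted trace. [folklore] -/
theorem sourcedTrace_zero (L : ℕ) :
    sourcedTrace d L ((0 : Current (freeBoxGraph d L)), (0 : Current (freeBoxGraph d L))) = ∅ := by
  rw [sourcedTrace, add_zero]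
  have h0 : (0 : Current (freeBoxGraph d L)).traced = ∅ := by
    ext e
    simp [Current.traced]
  rw [h0, liftBonds, Set.image_empty]

open Classical in
/-- **`P^{∅,∅}_{Λ_L,0} = δ_∅`**: at `β = 0` both currents vanish identically, so the trace is the
closed configuration. [folklore] -/
theorem sourcedDoubleCurrentLaw_zero_beta_real (L : ℕ) {S : Set (BondConfig (Site d))}
    (hS : MeasurableSet S) :
    (sourcedDoubleCurrentLaw d L 0 ∅ ∅).real S = if (∅ : BondConfig (Site d)) ∈ S then 1 else 0 := by
  classical
  set G := freeBoxGraph d L with hG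
  have hZ : currentSum G 0 (∅ : Finset (BoxVertex d L)) = 1 := by
    rw [currentSum_zero_beta]; simp
  have hE' : MeasurableSet (sourcedTrace d L ⁻¹' S) := (Set.to_countable _).measurableSet
  have hZ1 : currentSum G 0 (∅ : Finset (BoxVertex d L)) * currentSum G 0 ∅ ≠ 0 := by
    rw [hZ]; norm_num
  have h := doubleCurrentMeasure_real_mul G 0 le_rfl ∅ ∅ hE' hZ1
  rw [hZ, mul_one, mul_one] at h
  rw [measureReal_def, sourcedDoubleCurrentLaw_apply L 0 ∅ ∅ hS, ← measureReal_def, boxSources_empty, h]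
  have hpw : ∀ p : Current G × Current G,
      pairWeight G 0 ∅ ∅ p * (sourcedTrace d L ⁻¹' S).indicator 1 p =
        if p = (0, 0) then (if (∅ : BondConfig (Site d)) ∈ S then (1 : ℝ) else 0) else 0 := by
    intro p
    by_cases hp : p = (0, 0)
    · subst hp
      have hw : pairWeight G 0 ∅ ∅ ((0 : Current G), (0 : Current G)) = 1 := by
        simp [pairWeight]
      rw [hw, one_mul, if_pos rfl, Set.indicator_apply, Set.mem_preimage, sourcedTrace_zero]
      simp
    · rw [if_neg hp]
      have hw : pairWeight G 0 ∅ ∅ p = 0 := by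
        unfold pairWeight
        split_ifs with hsrc
        · rw [Current.weight_zero_beta, Current.weight_zero_beta]
          have : p.1 ≠ 0 ∨ p.2 ≠ 0 := by
            by_contra h'
            push Not at h'
            exact hp (Prod.ext h'.1 h'.2)
          rcases this with h1 | h2
          · rw [if_neg h1, zero_mul]
          · rw [if_neg h2, mul_zero]
        · rfl
      rw [hw, zero_mul]
  simp_rw [hpw]
  rw [tsum_ite_eq]

/-- **`P^{∅,∅}_0 = δ_∅`**: the Dirac mass at the closed configuration is the local limit at `β = 0`. [folklore] -/
theorem isSourcedDoubleCurrentLimit_zero_beta :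
    IsSourcedDoubleCurrentLimit d 0 ∅ ∅ (Measure.dirac (∅ : BondConfig (Site d))) := by
  classical
  refine ⟨inferInstance, fun S hS => ?_⟩
  have hSm : MeasurableSet S := measurableSet_of_isLocalEvent_holds hS
  have h : ∀ L, (sourcedDoubleCurrentLaw d L 0 ∅ ∅).real S =
      (Measure.dirac (∅ : BondConfig (Site d))).real S := by
    intro L
    rw [sourcedDoubleCurrentLaw_zero_beta_real d L hSm, measureReal_def, Measure.dirac_apply' _ hSm,
      Set.indicator_apply]
    split_ifs <;> simp
  simp_rw [h]
  exact tendsto_const_nhds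

/-- `sourcedDoubleCurrentLawInf d 0 ∅ ∅ = δ_∅`. [folklore] -/
theorem sourcedDoubleCurrentLawInf_zero_beta :
    sourcedDoubleCurrentLawInf d 0 ∅ ∅ = Measure.dirac (∅ : BondConfig (Site d)) :=
  ((isSourcedDoubleCurrentLimit_zero_beta d).eq_lawInf).symm

/-- At `β = 0` the free box correlations are `⟨σ_A⟩⁰_{Λ_L;0,0} = 𝟙[A = ∅]` (`A ⊆ Λ_L`). [folklore] -/
theorem isingCorr_free_box_zero_beta (L : ℕ) {A : Finset (Site d)} (hA : A ⊆ box d L) :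
    isingCorr (zdGraph d) (box d L) 0 0 .free A = if A = ∅ then 1 else 0 := by
  classical
  have h1 := isingCorr_free_box_eq d L 0 (boxSources_subset_boxCore hA)
  rw [map_boxSources hA] at h1
  rw [h1, plusCurrentSum_freeBoxGraph_eq_currentSum, plusCurrentSum_freeBoxGraph_eq_currentSum,
    currentSum_zero_beta, currentSum_zero_beta, if_pos rfl, div_one]
  have hiff : boxSources d L A = ∅ ↔ A = ∅ := by
    constructor
    · intro h
      rw [← map_boxSources hA, h, Finset.map_empty]
    · rintro rfl
      exact boxSources_empty L
  by_cases hA0 : A = ∅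
  · rw [if_pos (hiff.2 hA0), if_pos hA0]
  · rw [if_neg (fun h => hA0 (hiff.1 h)), if_neg hA0]

/-- At `β = 0` the free state is `⟨σ_A⟩⁰_{0,0} = 𝟙[A = ∅]`. [folklore] -/
theorem freeCorr_zero_beta (A : Finset (Site d)) : freeCorr d 0 0 A = if A = ∅ then 1 else 0 := by
  have hlim := hasBoxLimit_isingCorr_free_holds (d := d) le_rfl le_rfl A
  obtain ⟨L₀, hL₀⟩ := exists_forall_subset_box d A
  refine tendsto_nhds_unique hlim (tendsto_const_nhds.congr' ?_)
  filter_upwards [eventually_ge_atTop L₀] with L hL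
  exact (isingCorr_free_box_zero_beta d L (hL₀ L hL)).symm

end BetaZero

/-! ### Far connections of a site under the box double currents -/

section FarConnection

variable (d : ℕ)

/-- The event "`b` is connected to a vertex outside `Λ_N`" is measurable. [folklore] -/
theorem measurableSet_connFar (b : Site d) (N : ℕ) :
    MeasurableSet {ω : BondConfig (Site d) | ∃ v, v ∉ box d N ∧ (openGraph ω).Reachable b v} := by
  have h : {ω : BondConfig (Site d) | ∃ v, v ∉ box d N ∧ (openGraph ω).Reachable b v} =
      ⋃ v ∈ {v : Site d | v ∉ box d N}, (openConn b v : Set (BondConfig (Site d))) := by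
    ext ω
    simp only [Set.mem_setOf_eq, Set.mem_iUnion, exists_prop]
    rfl
  rw [h]
  exact MeasurableSet.biUnion (Set.to_countable _) fun v _ => measurableSet_openConn_holds b v

/-- The event "`b` is connected to a vertex outside `Λ_N`" is increasing. [folklore] -/
theorem isUpperSet_connFar (b : Site d) (N : ℕ) :
    IsUpperSet {ω : BondConfig (Site d) | ∃ v, v ∉ box d N ∧ (openGraph ω).Reachable b v} := by
  rintro ω ω' hle ⟨v, hv, hbv⟩
  exact ⟨v, hv, hbv.mono (openGraph_mono hle)⟩

/-- **`P^{A,B}_{Λ_L,β}[b ↔ Λ_Nᶜ] ≤ P^{A,B}_{Λ_L,β}[b` is connected to distance `M]`** once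
`b + Λ_M ⊆ Λ_N`: the box double currents charge only lattice configurations, on which an open path
leaving `Λ_N` first leaves `b + Λ_M` through bonds touching it. [cite: AizenmanDuminilCopinSidoraviciusCMP2015, §3.2, remark after (3.11)] -/
theorem sourcedDoubleCurrentLaw_real_connFar_le_exitBoxEvent (L : ℕ) (β : ℝ) (A B : Finset (Site d))
    [IsFiniteMeasure (sourcedDoubleCurrentLaw d L β A B)] {b : Site d} {N M : ℕ}
    (hMN : shiftedBox b M ⊆ box d N) :
    (sourcedDoubleCurrentLaw d L β A B).real {ω | ∃ v, v ∉ box d N ∧ (openGraph ω).Reachable b v} ≤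
      (sourcedDoubleCurrentLaw d L β A B).real (exitBoxEvent d b M) := by
  have hSm := measurableSet_connFar d b N
  have hb : b ∈ shiftedBox b M := mem_shiftedBox_iff.2 (by rw [sub_self]; exact zero_mem_box d M)
  calc (sourcedDoubleCurrentLaw d L β A B).real {ω | ∃ v, v ∉ box d N ∧ (openGraph ω).Reachable b v}
      = (sourcedDoubleCurrentLaw d L β A B).real
          ({ω | ∃ v, v ∉ box d N ∧ (openGraph ω).Reachable b v} ∩ exitBoxEvent d b M) := by
        refine sourcedDoubleCurrentLaw_real_congr_lattice d L β A B hSm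
          (hSm.inter (measurableSet_exitBoxEvent d b M)) fun ω hω => ⟨fun h => ⟨h, ?_⟩, fun h => h.1⟩
        obtain ⟨v, hv, hbv⟩ := h
        exact exists_reachable_inter_edgesTouching (zdGraph d) (shiftedBox b M) hω hb
          (fun h' => hv (hMN h')) hbv
    _ ≤ (sourcedDoubleCurrentLaw d L β A B).real (exitBoxEvent d b M) :=
        measureReal_mono Set.inter_subset_right (measure_ne_top _ _)

end FarConnection


/-! ### Parity of `∂𝟙_T`, and `𝓕_B = ∅` for `#B` odd -/

section TraceSubcurrentParity

variable {V : Type*} [DecidableEq V]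

/-- **Handshake**: the finite set of pairs `T` has an even number of odd-degree vertices
(`∑_x deg_T(x) = 2 · #{non-diagonal pairs of T}`). [folklore] -/
theorem even_card_oddVertices (T : Finset (Sym2 V)) : Even #(oddVertices T) := by
  classical
  unfold oddVertices
  rw [← Finset.even_sum_iff_even_card_odd]
  set C : Finset V := T.biUnion fun e => e.toFinset with hC
  have hsum : ∑ u ∈ C, bondDegree T u =
      ∑ e ∈ T.filter (fun e => ¬e.IsDiag), #(C.filter fun u => u ∈ e) := by
    simp only [bondDegree, Finset.card_eq_sum_ones, Finset.sum_filter]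
    rw [Finset.sum_comm]
    refine Finset.sum_congr rfl fun e _ => ?_
    by_cases he : e.IsDiag <;> simp [he]
  rw [hsum]
  refine Finset.even_sum _ fun e he => ?_
  rw [Finset.mem_filter] at he
  obtain ⟨heT, hnd⟩ := he
  revert heT hnd
  induction e using Sym2.ind with
  | _ p q =>
    intro heT hnd
    have hpq : p ≠ q := fun h => hnd (Sym2.mk_isDiag_iff.2 h)
    have hfil : C.filter (fun u => u ∈ (s(p, q) : Sym2 V)) = {p, q} := by
      ext u
      simp only [Finset.mem_filter, Sym2.mem_iff, Finset.mem_insert, Finset.mem_singleton, hC,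
        Finset.mem_biUnion, Sym2.mem_toFinset]
      constructor
      · exact fun h => h.2
      · rintro (rfl | rfl)
        · exact ⟨⟨_, heT, Sym2.mem_mk_left _ _⟩, Or.inl rfl⟩
        · exact ⟨⟨_, heT, Sym2.mem_mk_right _ _⟩, Or.inr rfl⟩
    rw [hfil, Finset.card_pair hpq]
    exact even_two

/-- **`𝓕_B = ∅` when `#B` is odd**: no finite set of pairs has an odd number of odd-degree
vertices (ADC21: there is no current `m` with `#∂m` odd). [cite: AizenmanDuminilCopinAnnals2021, Def. 3.2] -/
theorem traceSubcurrentEvent_eq_empty_of_odd_card {B : Finset V} (hB : Odd #B) :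
    traceSubcurrentEvent B = (∅ : Set (BondConfig V)) := by
  ext ω
  simp only [mem_traceSubcurrentEvent_iff, Set.mem_empty_iff_false, iff_false, not_exists, not_and]
  intro T _ hTB
  have h := even_card_oddVertices T
  rw [hTB] at h
  exact (Nat.not_even_iff_odd.2 hB) h

/-! ### `𝓕_B` localised to a finite region, and the decomposition of `𝓕_B` -/

/-- **The localised events are local**: "`ω` contains a finite set of pairs `T` inside `S` with
`∂𝟙_T = B`" is determined by the pairs inside `S`. [folklore] -/
theorem determinedBy_traceSubcurrentEventIn (B S : Finset V) :
    DeterminedBy {ω : BondConfig V | ∃ T : Finset (Sym2 V), ↑T ⊆ ω ∧ (∀ e ∈ T, ∀ u ∈ e, u ∈ S) ∧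
      oddVertices T = B} (↑S.sym2 : Set (Sym2 V)) := by
  rw [determinedBy_iff]
  intro ω ω' h
  simp only [Set.mem_setOf_eq]
  have key : ∀ T : Finset (Sym2 V), (∀ e ∈ T, ∀ u ∈ e, u ∈ S) →
      ((↑T : Set (Sym2 V)) ⊆ ω ↔ (↑T : Set (Sym2 V)) ⊆ ω') := by
    intro T hT
    have hTF : (↑T : Set (Sym2 V)) ⊆ ↑S.sym2 := fun e he =>
      Finset.mem_coe.2 (Finset.mem_sym2_iff.2 (hT e (Finset.mem_coe.1 he)))
    constructor
    · intro hTω e he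
      have h1 : e ∈ ω ∩ ↑S.sym2 := ⟨hTω he, hTF he⟩
      rw [h] at h1
      exact h1.1
    · intro hTω e he
      have h1 : e ∈ ω' ∩ ↑S.sym2 := ⟨hTω he, hTF he⟩
      rw [← h] at h1
      exact h1.1
  constructor
  · rintro ⟨T, hTω, hT, hTB⟩
    exact ⟨T, (key T hT).1 hTω, hT, hTB⟩
  · rintro ⟨T, hTω, hT, hTB⟩
    exact ⟨T, (key T hT).2 hTω, hT, hTB⟩

/-- The localised events are local events. [folklore] -/
theorem isLocalEvent_traceSubcurrentEventIn (B S : Finset V) :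
    IsLocalEvent {ω : BondConfig V | ∃ T : Finset (Sym2 V), ↑T ⊆ ω ∧ (∀ e ∈ T, ∀ u ∈ e, u ∈ S) ∧
      oddVertices T = B} :=
  ⟨S.sym2, determinedBy_traceSubcurrentEventIn B S⟩

omit [DecidableEq V] in
/-- Two distinct elements of a pair are adjacent in the graph of a set of pairs containing it. [folklore] -/
theorem openGraph_adj_of_mem_of_mem {T : Set (Sym2 V)} {e : Sym2 V} (he : e ∈ T) {u x : V}
    (hu : u ∈ e) (hx : x ∈ e) (hux : u ≠ x) : (openGraph T).Adj u x := by
  rw [openGraph_adj]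
  have h : e = s(u, x) := (Sym2.mem_and_mem_iff hux).1 ⟨hu, hx⟩
  exact ⟨h ▸ he, hux⟩

/-- **Decomposition of `𝓕_B`** (the locality step of the passage to infinite volume in ADC21
(3.10)): if `ω ∈ 𝓕_B` then either `ω` contains a finite set of pairs *inside `S`* with odd-degree
vertices `B` — restrict a witness `T` to its connected components meeting `B`, which does not
change the degrees at the vertices reached from `B` and removes all others — or some `b ∈ B` is
connected in `ω` to a vertex outside `S`. [cite: AizenmanDuminilCopinAnnals2021, §3.2, footnote 5] -/
theorem traceSubcurrentEvent_subset_union (B S : Finset V) :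
    (traceSubcurrentEvent B : Set (BondConfig V)) ⊆
      {ω | ∃ T : Finset (Sym2 V), ↑T ⊆ ω ∧ (∀ e ∈ T, ∀ u ∈ e, u ∈ S) ∧ oddVertices T = B} ∪
        ⋃ b ∈ B, {ω | ∃ v, v ∉ S ∧ (openGraph ω).Reachable b v} := by
  classical
  rintro ω ⟨T, hTω, hTB⟩
  -- `R u`: `u` is reached from `B` along pairs of `T`
  set R : V → Prop := fun u => ∃ b ∈ B, (openGraph (↑T : Set (Sym2 V))).Reachable b u with hR
  have hRe : ∀ e ∈ T, ¬e.IsDiag → ∀ u ∈ e, R u → ∀ x ∈ e, R x := by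
    intro e he _ u hu hRu x hx
    by_cases hux : u = x
    · exact hux ▸ hRu
    · obtain ⟨b, hb, hbu⟩ := hRu
      exact ⟨b, hb, hbu.trans (openGraph_adj_of_mem_of_mem (Finset.mem_coe.2 he) hu hx hux).reachable⟩
  have hRB : ∀ b ∈ B, R b := fun b hb => ⟨b, hb, SimpleGraph.Reachable.refl _⟩
  -- the restriction of `T` to the components meeting `B`
  set T' : Finset (Sym2 V) := T.filter fun e => ¬e.IsDiag ∧ ∃ u ∈ e, R u with hT'
  have hdeg1 : ∀ x, R x → bondDegree T' x = bondDegree T x := by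
    intro x hx
    have hfil : T'.filter (fun e => x ∈ e ∧ ¬e.IsDiag) = T.filter (fun e => x ∈ e ∧ ¬e.IsDiag) := by
      ext e
      simp only [Finset.mem_filter, hT']
      constructor
      · rintro ⟨⟨he, -, -⟩, hxe, hnd⟩
        exact ⟨he, hxe, hnd⟩
      · rintro ⟨he, hxe, hnd⟩
        exact ⟨⟨he, hnd, x, hxe, hx⟩, hxe, hnd⟩
    unfold bondDegree
    rw [hfil]
  have hdeg0 : ∀ x, ¬R x → bondDegree T' x = 0 := by
    intro x hx
    unfold bondDegree
    rw [Finset.card_eq_zero, Finset.filter_eq_empty_iff]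
    rintro e he ⟨hxe, hnd⟩
    rw [hT', Finset.mem_filter] at he
    obtain ⟨heT, -, u, hu, hRu⟩ := he
    exact hx (hRe e heT hnd u hu hRu x hxe)
  have hodd' : oddVertices T' = B := by
    ext x
    rw [mem_oddVertices_iff]
    by_cases hx : R x
    · rw [hdeg1 x hx, ← mem_oddVertices_iff, hTB]
    · rw [hdeg0 x hx]
      constructor
      · intro h
        exact absurd h (Nat.not_odd_iff_even.2 (Even.zero))
      · intro hxB
        exact absurd (hRB x hxB) hx
  by_cases hin : ∀ e ∈ T', ∀ u ∈ e, u ∈ S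
  · left
    exact ⟨T', (Finset.coe_subset.2 (Finset.filter_subset _ _)).trans hTω, hin, hodd'⟩
  · right
    push Not at hin
    obtain ⟨e, he, v, hv, hvS⟩ := hin
    rw [hT', Finset.mem_filter] at he
    obtain ⟨heT, hnd, u, hu, hRu⟩ := he
    obtain ⟨b, hb, hbv⟩ := hRe e heT hnd u hu hRu v hv
    simp only [Set.mem_iUnion, Set.mem_setOf_eq]
    exact ⟨b, hb, v, hvS, hbv.mono (openGraph_mono hTω)⟩

/-- Parity of the cardinality of a symmetric difference: odd and even give odd. [folklore] -/
theorem odd_card_symmDiff_of_odd_of_even {A B : Finset V} (hA : Odd #A) (hB : Even #B) :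
    Odd #(A ∆ B) := by
  have h := Current.card_symmDiff_add A B
  obtain ⟨a, ha⟩ := hA
  obtain ⟨b, hb⟩ := hB
  exact ⟨a + b - #(A ∩ B), by omega⟩

/-- Parity of the cardinality of a symmetric difference: even and even give even. [folklore] -/
theorem even_card_symmDiff_of_even_of_even {A B : Finset V} (hA : Even #A) (hB : Even #B) :
    Even #(A ∆ B) := by
  have h := Current.card_symmDiff_add A B
  obtain ⟨a, ha⟩ := hA
  obtain ⟨b, hb⟩ := hB
  exact ⟨a + b - #(A ∩ B), by omega⟩

end TraceSubcurrentParity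

/-! ### ADC21 (3.10): the proof -/

section MainProof

variable {d : ℕ}

/-- Translated boxes around the points of a finite set lie in a common box. [folklore] -/
theorem exists_forall_shiftedBox_subset_box (B : Finset (Site d)) (M : ℕ) :
    ∃ N : ℕ, ∀ b ∈ B, shiftedBox b M ⊆ box d N := by
  obtain ⟨K, hK⟩ := exists_forall_subset_box d B
  refine ⟨K + M, fun b hb y hy => ?_⟩
  have hb' : b ∈ box d K := hK K le_rfl hb
  refine image_add_box_subset hb' (Finset.mem_image.2 ⟨y - b, mem_shiftedBox_iff.1 hy, ?_⟩)
  exact sub_add_cancel y b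

/-- **The case `β = 0` of ADC21 (3.10)**: `⟨σ_A⟩⁰_0 = 𝟙[A = ∅]` and `P^{∅,∅}_0 = δ_∅`, for which
`𝓕_B` holds iff `B = ∅`. [cite: AizenmanDuminilCopinAnnals2021, eq. (3.10)] -/
theorem freeCorr_mul_eq_sourcedDoubleCurrent_subcurrent_zero_beta (A B : Finset (Site d)) :
    freeCorr d 0 0 A * freeCorr d 0 0 B =
      freeCorr d 0 0 (A ∆ B) *
        (sourcedDoubleCurrentLawInf d 0 (A ∆ B) ∅).real (traceSubcurrentEvent B) := by
  classical
  rw [freeCorr_zero_beta, freeCorr_zero_beta, freeCorr_zero_beta]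
  by_cases hAB : A ∆ B = ∅
  · have hBA : A = B := symmDiff_eq_bot.1 hAB
    subst hBA
    rw [if_pos hAB, hAB, sourcedDoubleCurrentLawInf_zero_beta, measureReal_def,
      Measure.dirac_apply' _ (measurableSet_traceSubcurrentEvent A), Set.indicator_apply]
    by_cases hA : A = ∅
    · subst hA
      simp [traceSubcurrentEvent_empty]
    · have hnot : (∅ : BondConfig (Site d)) ∉ traceSubcurrentEvent A := by
        rintro ⟨T, hT, hTA⟩
        have hT0 : T = ∅ := Finset.coe_eq_empty.1 (Set.subset_empty_iff.1 hT)
        rw [hT0, oddVertices_empty] at hTA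
        exact hA hTA.symm
      simp [hA, hnot]
  · rw [if_neg hAB, zero_mul]
    have h : A ≠ ∅ ∨ B ≠ ∅ := by
      by_contra h'
      push Not at h'
      obtain ⟨rfl, rfl⟩ := h'
      exact hAB (symmDiff_self _)
    rcases h with hA | hB
    · rw [if_neg hA, zero_mul]
    · rw [if_neg hB, mul_zero]

/-- **The odd cases of ADC21 (3.10)** (`β ≥ 0`): if `#A` or `#B` is odd both sides vanish
(`⟨σ_X⟩⁰ = 0` for `#X` odd, and `𝓕_B = ∅` for `#B` odd). [cite: AizenmanDuminilCopinAnnals2021, eq. (3.10)] -/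
theorem freeCorr_mul_eq_sourcedDoubleCurrent_subcurrent_of_odd {β : ℝ} (hβ : 0 ≤ β)
    {A B : Finset (Site d)} (h : Odd #A ∨ Odd #B) :
    freeCorr d β 0 A * freeCorr d β 0 B =
      freeCorr d β 0 (A ∆ B) *
        (sourcedDoubleCurrentLawInf d β (A ∆ B) ∅).real (traceSubcurrentEvent B) := by
  rcases Nat.even_or_odd #B with hBe | hBo
  · have hAo : Odd #A := h.resolve_right (Nat.not_odd_iff_even.2 hBe)
    rw [freeCorr_eq_zero_of_odd_card hβ hAo, zero_mul,
      freeCorr_eq_zero_of_odd_card hβ (odd_card_symmDiff_of_odd_of_even hAo hBe), zero_mul]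
  · rw [freeCorr_eq_zero_of_odd_card hβ hBo, mul_zero, traceSubcurrentEvent_eq_empty_of_odd_card hBo,
      measureReal_empty, mul_zero]

/-- **The main case of ADC21 (3.10)** (`d ≥ 2`, `0 < β ≤ β_c(d)`, `#A`, `#B` even), granted the
finite-volume identities (3.7) in the boxes `Λ_L`: the passage `L → ∞`.
`P_L[𝓕_B] = ⟨σ_A⟩_L⟨σ_B⟩_L/⟨σ_{A∆B}⟩_L → p* = ⟨σ_A⟩⟨σ_B⟩/⟨σ_{A∆B}⟩`; `P[𝓕_B] ≤ p*` by the local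
approximation of `𝓕_B` from inside; `p* ≤ P[𝓕_B]` because `𝓕_B ∖ 𝓕_B^{Λ_N} ⊆ ⋃_{b ∈ B} {b ↔ Λ_Nᶜ}`,
whose `P^{A∆B,∅}_{Λ_L}`-probability is at most `C · ∑_b P^{∅,∅}_{Λ_L}[b` connected to distance `M]`
(source insertion), which tends to `C ∑_b P^{∅,∅}_β[⋯] → 0` (`M → ∞`; no percolation of the
sourceless double current, footnote 5 of ADC21). [cite: AizenmanDuminilCopinAnnals2021, eq. (3.10) with footnote 5] -/
theorem freeCorr_mul_eq_sourcedDoubleCurrent_subcurrent_of_finiteVolume (hd : 2 ≤ d) {β : ℝ}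
    (hβ : 0 < β) (hβc : β ≤ criticalBeta d) {A B : Finset (Site d)} (hAe : Even #A) (hBe : Even #B)
    {L₁ : ℕ}
    (hfin : ∀ L, L₁ ≤ L →
      isingCorr (zdGraph d) (box d L) β 0 .free A * isingCorr (zdGraph d) (box d L) β 0 .free B =
        isingCorr (zdGraph d) (box d L) β 0 .free (A ∆ B) *
          (sourcedDoubleCurrentLaw d L β (A ∆ B) ∅).real (traceSubcurrentEvent B)) :
    freeCorr d β 0 A * freeCorr d β 0 B =
      freeCorr d β 0 (A ∆ B) *
        (sourcedDoubleCurrentLawInf d β (A ∆ B) ∅).real (traceSubcurrentEvent B) := by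
  classical
  have hSe : Even #(A ∆ B) := even_card_symmDiff_of_even_of_even hAe hBe
  -- limits of the correlations
  have ha := hasBoxLimit_isingCorr_free_holds (d := d) hβ.le le_rfl A
  have hb := hasBoxLimit_isingCorr_free_holds (d := d) hβ.le le_rfl B
  have hs := hasBoxLimit_isingCorr_free_holds (d := d) hβ.le le_rfl (A ∆ B)
  have hspos : 0 < freeCorr d β 0 (A ∆ B) := freeCorr_pos d hβ hSe
  -- the limit measures
  have hP := isSourcedDoubleCurrentLimit_lawInf
    (exists_isSourcedDoubleCurrentLimit d hβ (A := A ∆ B) (B := ∅) hSe (by simp))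
  haveI := hP.isProbabilityMeasure
  have hQ := isSourcedDoubleCurrentLimit_lawInf
    (exists_isSourcedDoubleCurrentLimit d hβ (A := ∅) (B := ∅) (by simp) (by simp))
  haveI := hQ.isProbabilityMeasure
  -- the finite-volume laws are probability measures
  obtain ⟨L₂, hL₂⟩ := exists_forall_subset_box d (A ∆ B)
  have hprobS : ∀ L, L₂ ≤ L → IsProbabilityMeasure (sourcedDoubleCurrentLaw d L β (A ∆ B) ∅) := by
    intro L hL
    refine isProbabilityMeasure_sourcedDoubleCurrentLaw hβ.le (currentSum_boxSources_pos d hβ (hL₂ L hL) hSe).ne' ?_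
    rw [boxSources_empty]
    exact (currentSum_empty_pos' _ β).ne'
  have hprob0 : ∀ L, IsProbabilityMeasure (sourcedDoubleCurrentLaw d L β ∅ ∅) := by
    intro L
    have hZ : currentSum (freeBoxGraph d L) β (boxSources d L ∅) ≠ 0 := by
      rw [boxSources_empty]
      exact (currentSum_empty_pos' _ β).ne'
    exact isProbabilityMeasure_sourcedDoubleCurrentLaw hβ.le hZ hZ
  -- `P_L[𝓕_B] → p* = ⟨σ_A⟩⟨σ_B⟩/⟨σ_{A∆B}⟩`
  set pstar := freeCorr d β 0 A * freeCorr d β 0 B / freeCorr d β 0 (A ∆ B) with hpstar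
  have hpL : Tendsto (fun L : ℕ => (sourcedDoubleCurrentLaw d L β (A ∆ B) ∅).real (traceSubcurrentEvent B))
      atTop (𝓝 pstar) := by
    have h1 : Tendsto (fun L : ℕ => isingCorr (zdGraph d) (box d L) β 0 .free A *
        isingCorr (zdGraph d) (box d L) β 0 .free B / isingCorr (zdGraph d) (box d L) β 0 .free (A ∆ B))
        atTop (𝓝 pstar) :=
      (ha.mul hb).div hs hspos.ne'
    refine h1.congr' ?_
    filter_upwards [eventually_ge_atTop L₁, hs.eventually_ne hspos.ne'] with L hL hsL
    rw [hfin L hL, mul_div_cancel_left₀ _ hsL]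
  suffices hkey : (sourcedDoubleCurrentLawInf d β (A ∆ B) ∅).real (traceSubcurrentEvent B) = pstar by
    rw [hkey, hpstar, mul_div_cancel₀ _ hspos.ne']
  -- local approximations of `𝓕_B` from inside
  set Floc : ℕ → Set (BondConfig (Site d)) := fun N =>
    {ω | ∃ T : Finset (Sym2 (Site d)), ↑T ⊆ ω ∧ (∀ e ∈ T, ∀ u ∈ e, u ∈ box d N) ∧ oddVertices T = B}
    with hFloc
  have hFloc_local : ∀ N, IsLocalEvent (Floc N) := fun N =>
    isLocalEvent_traceSubcurrentEventIn B (box d N)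
  have hFloc_mono : Monotone Floc := by
    intro N N' h ω hω
    obtain ⟨T, hT, hTin, hTB⟩ := hω
    exact ⟨T, hT, fun e he u hu => box_mono d h (hTin e he u hu), hTB⟩
  have hFloc_sub : ∀ N, Floc N ⊆ traceSubcurrentEvent B := by
    intro N ω hω
    obtain ⟨T, hT, -, hTB⟩ := hω
    exact ⟨T, hT, hTB⟩
  have hFloc_union : ⋃ N, Floc N = traceSubcurrentEvent B := by
    refine subset_antisymm (Set.iUnion_subset hFloc_sub) ?_
    rintro ω ⟨T, hT, hTB⟩
    obtain ⟨N, hN⟩ := exists_forall_subset_box d (T.biUnion fun e => e.toFinset)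
    exact Set.mem_iUnion.2 ⟨N, T, hT, fun e he u hu =>
      hN N le_rfl (Finset.mem_biUnion.2 ⟨e, he, Sym2.mem_toFinset.2 hu⟩), hTB⟩
  -- `P[Floc N] → P[𝓕_B]`
  have hPunion : Tendsto (fun N => (sourcedDoubleCurrentLawInf d β (A ∆ B) ∅).real (Floc N)) atTop
      (𝓝 ((sourcedDoubleCurrentLawInf d β (A ∆ B) ∅).real (traceSubcurrentEvent B))) := by
    have h := tendsto_measure_iUnion_atTop (μ := sourcedDoubleCurrentLawInf d β (A ∆ B) ∅) hFloc_mono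
    rw [hFloc_union] at h
    exact (ENNReal.tendsto_toReal (measure_ne_top _ _)).comp h
  -- `P_L[Floc N] → P[Floc N]`
  have hPloc : ∀ N, Tendsto (fun L : ℕ => (sourcedDoubleCurrentLaw d L β (A ∆ B) ∅).real (Floc N)) atTop
      (𝓝 ((sourcedDoubleCurrentLawInf d β (A ∆ B) ∅).real (Floc N))) :=
    fun N => hP.tendsto_local _ (hFloc_local N)
  -- (≤)
  have hle1 : ∀ N, (sourcedDoubleCurrentLawInf d β (A ∆ B) ∅).real (Floc N) ≤ pstar := by
    intro N
    refine le_of_tendsto_of_tendsto (hPloc N) hpL ?_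
    filter_upwards [eventually_ge_atTop L₂] with L hL
    haveI := hprobS L hL
    exact measureReal_mono (hFloc_sub N) (measure_ne_top _ _)
  have hle : (sourcedDoubleCurrentLawInf d β (A ∆ B) ∅).real (traceSubcurrentEvent B) ≤ pstar :=
    le_of_tendsto' hPunion hle1
  -- (≥)
  have hge : pstar ≤ (sourcedDoubleCurrentLawInf d β (A ∆ B) ∅).real (traceSubcurrentEvent B) := by
    obtain ⟨C, L₀, hC0, hC⟩ := exists_sourcedDoubleCurrentLaw_real_le_empty d hβ hSe
    refine le_of_forall_pos_le_add fun ε hε => ?_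
    -- `M` with `C · P^{∅,∅}_β[b connected to distance M] < ε/(#B+1)` for all `b ∈ B`
    have hε' : 0 < ε / ((C + 1) * (#B + 1)) := by positivity
    have hexit : ∀ b ∈ B, ∀ᶠ M : ℕ in atTop,
        (sourcedDoubleCurrentLawInf d β ∅ ∅).real (exitBoxEvent d b M) < ε / ((C + 1) * (#B + 1)) :=
      fun b _ => (tendsto_order.1
        (tendsto_sourcedDoubleCurrentLawInf_empty_real_exitBoxEvent d hd hβ hβc b)).2 _ hε'
    obtain ⟨M, hM⟩ := ((Finset.eventually_all B).2 hexit).exists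
    obtain ⟨N, hN⟩ := exists_forall_shiftedBox_subset_box B M
    -- the upper bound in finite volume
    set uL : ℕ → ℝ := fun L => (sourcedDoubleCurrentLaw d L β (A ∆ B) ∅).real (Floc N) +
      C * ∑ b ∈ B, (sourcedDoubleCurrentLaw d L β ∅ ∅).real (exitBoxEvent d b M) with huL
    have huL_tendsto : Tendsto uL atTop (𝓝 ((sourcedDoubleCurrentLawInf d β (A ∆ B) ∅).real (Floc N) +
        C * ∑ b ∈ B, (sourcedDoubleCurrentLawInf d β ∅ ∅).real (exitBoxEvent d b M))) :=
      (hPloc N).add ((tendsto_finsetSum B fun b _ =>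
        hQ.tendsto_local _ (isLocalEvent_exitBoxEvent d b M)).const_mul C)
    have hpu : ∀ᶠ L : ℕ in atTop,
        (sourcedDoubleCurrentLaw d L β (A ∆ B) ∅).real (traceSubcurrentEvent B) ≤ uL L := by
      filter_upwards [eventually_ge_atTop L₀, eventually_ge_atTop L₂] with L hL0 hL2
      haveI := hprobS L hL2
      haveI := hprob0 L
      have hdec := traceSubcurrentEvent_subset_union B (box d N)
      calc (sourcedDoubleCurrentLaw d L β (A ∆ B) ∅).real (traceSubcurrentEvent B)
          ≤ (sourcedDoubleCurrentLaw d L β (A ∆ B) ∅).real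
              (Floc N ∪ ⋃ b ∈ B, {ω | ∃ v, v ∉ box d N ∧ (openGraph ω).Reachable b v}) :=
            measureReal_mono hdec (measure_ne_top _ _)
        _ ≤ (sourcedDoubleCurrentLaw d L β (A ∆ B) ∅).real (Floc N) +
              (sourcedDoubleCurrentLaw d L β (A ∆ B) ∅).real
                (⋃ b ∈ B, {ω | ∃ v, v ∉ box d N ∧ (openGraph ω).Reachable b v}) :=
            measureReal_union_le _ _
        _ ≤ (sourcedDoubleCurrentLaw d L β (A ∆ B) ∅).real (Floc N) +
              ∑ b ∈ B, (sourcedDoubleCurrentLaw d L β (A ∆ B) ∅).real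
                {ω | ∃ v, v ∉ box d N ∧ (openGraph ω).Reachable b v} := by
            gcongr
            exact measureReal_biUnion_finset_le _ _
        _ ≤ (sourcedDoubleCurrentLaw d L β (A ∆ B) ∅).real (Floc N) +
              ∑ b ∈ B, C * (sourcedDoubleCurrentLaw d L β ∅ ∅).real (exitBoxEvent d b M) := by
            gcongr with b hb
            exact (hC L hL0 _ (measurableSet_connFar d b N) (isUpperSet_connFar d b N)).trans
              (mul_le_mul_of_nonneg_left
                (sourcedDoubleCurrentLaw_real_connFar_le_exitBoxEvent d L β ∅ ∅ (hN b hb)) hC0)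
        _ = uL L := by simp only [huL, Finset.mul_sum]
    have h1 : pstar ≤ (sourcedDoubleCurrentLawInf d β (A ∆ B) ∅).real (Floc N) +
        C * ∑ b ∈ B, (sourcedDoubleCurrentLawInf d β ∅ ∅).real (exitBoxEvent d b M) :=
      le_of_tendsto_of_tendsto hpL huL_tendsto hpu
    have h2 : (sourcedDoubleCurrentLawInf d β (A ∆ B) ∅).real (Floc N) ≤
        (sourcedDoubleCurrentLawInf d β (A ∆ B) ∅).real (traceSubcurrentEvent B) :=
      measureReal_mono (hFloc_sub N) (measure_ne_top _ _)
    have h3 : C * ∑ b ∈ B, (sourcedDoubleCurrentLawInf d β ∅ ∅).real (exitBoxEvent d b M) ≤ ε := by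
      have hsum : ∑ b ∈ B, (sourcedDoubleCurrentLawInf d β ∅ ∅).real (exitBoxEvent d b M) ≤
          ∑ b ∈ B, ε / ((C + 1) * (#B + 1)) :=
        Finset.sum_le_sum fun b hb => (hM b hb).le
      rw [Finset.sum_const, nsmul_eq_mul] at hsum
      calc C * ∑ b ∈ B, (sourcedDoubleCurrentLawInf d β ∅ ∅).real (exitBoxEvent d b M)
          ≤ C * (#B * (ε / ((C + 1) * (#B + 1)))) := mul_le_mul_of_nonneg_left hsum hC0
        _ = ε * (C / (C + 1)) * (#B / (#B + 1)) := by
            field_simp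
        _ ≤ ε * 1 * 1 := by
            gcongr
            · exact (div_le_one (by linarith)).2 (by linarith)
            · exact (div_le_one (by positivity)).2 (by linarith)
        _ = ε := by ring
    linarith
  exact le_antisymm hle hge

/-- **ADC21 eq. (3.10), proved**: the discharge of the named fact
`freeCorr_mul_eq_sourcedDoubleCurrent_subcurrent` — for the nearest-neighbour Ising model on `ℤ^d`,
`d ≥ 2`, `0 ≤ β ≤ β_c(d)` and finite `A, B`,
`⟨σ_A⟩⁰_β ⟨σ_B⟩⁰_β = ⟨σ_{A∆B}⟩⁰_β · P^{A∆B,∅}_β[𝓕_B]`. The finite-volume identity (3.7) is the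
tree's `isingCorr_free_box_mul_eq`; the passage to the limit (ADC21 §3.2 with footnote 5: no
infinite paths under the sourced double current for `β ≤ β_c`) is
`freeCorr_mul_eq_sourcedDoubleCurrent_subcurrent_of_finiteVolume`. [cite: AizenmanDuminilCopinAnnals2021, eq. (3.10)] -/
theorem freeCorr_mul_eq_sourcedDoubleCurrent_subcurrent_holds :
    freeCorr_mul_eq_sourcedDoubleCurrent_subcurrent d := by
  intro hd β hβ hβc A B
  rcases hβ.eq_or_lt with hβ0 | hβpos
  · subst hβ0
    exact freeCorr_mul_eq_sourcedDoubleCurrent_subcurrent_zero_beta A B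
  rcases Nat.even_or_odd #A with hAe | hAo
  · rcases Nat.even_or_odd #B with hBe | hBo
    · obtain ⟨L₁, hL₁⟩ := exists_forall_subset_box d (A ∪ B)
      exact freeCorr_mul_eq_sourcedDoubleCurrent_subcurrent_of_finiteVolume hd hβpos hβc hAe hBe
        (L₁ := L₁) fun L hL => isingCorr_free_box_mul_eq d L hβ (Finset.subset_union_left.trans (hL₁ L hL))
          (Finset.subset_union_right.trans (hL₁ L hL))
    · exact freeCorr_mul_eq_sourcedDoubleCurrent_subcurrent_of_odd hβ (Or.inr hBo)
  · exact freeCorr_mul_eq_sourcedDoubleCurrent_subcurrent_of_odd hβ (Or.inl hAo)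

end MainProof

/-! ## ADC21 (3.11) in infinite volume, proved: the discharge of `freeUrsellFour_eq_sourcedDoubleCurrent`

The second named fact of `SourcedDoubleCurrentsSwitching.lean`,
`U₄^β(x,y,z,t) = -2⟨σ_xσ_y⟩_β⟨σ_zσ_t⟩_β · P^{{x}∆{y},{z}∆{t}}_β[x ↔ z]` (Aizenman–Duminil-Copin 2021,
§3.2, eq. (3.11) of arXiv:1912.07973, read on p. 9 of the held text: "Combining (3.10) for the
different values of the product of spin-spin correlations leads to (3.11)", under the same
footnote 5 as (3.10)), for the nearest-neighbour Ising model on `ℤ^d`, `d ≥ 2`, `0 ≤ β ≤ β_c(d)`.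

The finite-volume identity is the tree theorem `connectedFour_free_box_eq`; all spin expectations
converge by the existence of the free state. The content is again the passage `L → ∞` on a
NON-LOCAL increasing event, here `{x ↔ z}` under the sourced current `P^{{x}∆{y},{z}∆{t}}` whose
BOTH currents carry sources, along the route of the first part of this file:

* *source insertion for both currents* (ADS15 (3.8)–(3.9)): the second-current form
  `tsum_pairWeight_mul_indicator_le_of_walk_snd` of `tsum_pairWeight_mul_indicator_le_of_walk` (swap
  the currents) and the two together (`tsum_pairWeight_mul_indicator_le_of_walks`), giving
  `P^{{x}∆{y},{z}∆{t}}_{Λ_L}[E] ⟨σ_xσ_y⟩⁰_{Λ_L}⟨σ_zσ_t⟩⁰_{Λ_L} ≤ tanh(β/2)^{-(k+l)} P^{∅,∅}_{Λ_L}[E]` for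
  increasing `E` (`sourcedDoubleCurrentLaw_pair_real_mul_le`), uniformly in `L`
  (`exists_sourcedDoubleCurrentLaw_pair_real_le_empty`: walks of bounded length inside a fixed box,
  `exists_walk_freeBoxGraph_length_le`, and `⟨σ_xσ_y⟩⁰_{Λ_L} ≥ ⟨σ_xσ_y⟩⁰_{Λ_{L₀}} > 0`);
* *no percolation of the sourced current* (footnote 5): `P^{{x}∆{y},{z}∆{t}}_β[v` connected to
  distance `N] → 0` (`tendsto_sourcedDoubleCurrentLawInf_pair_real_exitBoxEvent`), from the
  sourceless statement `tendsto_sourcedDoubleCurrentLawInf_empty_real_exitBoxEvent` above;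
* *the squeeze* `P_L[x ↔ z inside x+Λ_N] ≤ P_L[x ↔ z] ≤ P_L[x ↔ z inside x+Λ_N] + P_L[x` connected to
  distance `N]` between local events, on the lattice configurations charged by `P_L`
  (`openConn_subset_openConnVia_union_exitBoxEvent`), whence `P_L[x ↔ z] → P_β[x ↔ z]`
  (`tendsto_sourcedDoubleCurrentLaw_real_openConn`; a.e. configuration of `P_β` is a lattice
  configuration, `IsSourcedDoubleCurrentLimit.ae_subset_edgeSet`);
* `β = 0`: all currents vanish; both sides are `0` unless `x = y` and `z = t`, where
  `P^{∅,∅}_{Λ_L,0} = δ_∅ = P^{∅,∅}_0` (`sourcedDoubleCurrentLaw_zero_beta_real`,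
  `sourcedDoubleCurrentLawInf_zero_beta`).
-/

/-! ### Source insertion in the second current, and in both -/

section InsertionPair

variable {V : Type*} [Fintype V] [DecidableEq V] (G : SimpleGraph V) [DecidableRel G.Adj]

/-- Swapping the two currents exchanges the source constraints of the pair weight. [folklore] -/
theorem pairWeight_swap (β : ℝ) (A B : Finset V) (p : Current G × Current G) :
    pairWeight G β A B p.swap = pairWeight G β B A p := by
  rw [pairWeight_eq_mul, pairWeight_eq_mul, Prod.fst_swap, Prod.snd_swap, mul_comm]

/-- **Resetting two sources of the second current along a walk** (ADS15 (3.8)–(3.9) for the second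
current of a pair, by swapping the currents in `tsum_pairWeight_mul_indicator_le_of_walk`): for
`β > 0`, an event `E` increasing in the trace of the second current and a walk of length `k` from
`z` to `t`, `∑ 𝟙{∂n₁=A}𝟙{∂n₂=B} w w 𝟙_E ≤ tanh(β/2)^{-k} ∑ 𝟙{∂n₁=A}𝟙{∂n₂=B∆{z}∆{t}} w w 𝟙_E`. [cite: AizenmanDuminilCopinSidoraviciusCMP2015, §3.2, eqs. (3.8)–(3.9)] -/
theorem tsum_pairWeight_mul_indicator_le_of_walk_snd {β : ℝ} (hβ : 0 < β) (A B : Finset V)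
    {E : Set (Current G × Current G)}
    (hE : ∀ n₁ n₂ n₂' : Current G, n₂.traced ⊆ n₂'.traced → (n₁, n₂) ∈ E → (n₁, n₂') ∈ E)
    {z t : V} (q : G.Walk z t) :
    ∑' r : Current G × Current G, pairWeight G β A B r * E.indicator 1 r ≤
      (Real.tanh (β / 2))⁻¹ ^ q.length *
        ∑' r : Current G × Current G, pairWeight G β A (B ∆ ({z} ∆ {t})) r * E.indicator 1 r := by
  have hswap : ∀ B₀ : Finset V, ∑' r : Current G × Current G, pairWeight G β A B₀ r * E.indicator 1 r =
      ∑' r : Current G × Current G, pairWeight G β B₀ A r * (Prod.swap ⁻¹' E).indicator 1 r := by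
    intro B₀
    rw [← (Equiv.prodComm (Current G) (Current G)).tsum_eq fun r => pairWeight G β A B₀ r * E.indicator 1 r]
    refine tsum_congr fun r => ?_
    rw [Equiv.prodComm_apply, pairWeight_swap]
    congr 1
  rw [hswap B, hswap (B ∆ ({z} ∆ {t}))]
  exact tsum_pairWeight_mul_indicator_le_of_walk G hβ B A (fun n₁ n₁' n₂ h h1 => hE n₂ n₁ n₁' h h1) q

/-- **Resetting the pair sources of both currents** (ADS15 (3.8)–(3.9) applied to each current):
for `β > 0`, an event `E` increasing in both traces and walks `x ⇝ y`, `z ⇝ t` of lengths `k`, `l`,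
`∑ 𝟙{∂n₁={x}∆{y}}𝟙{∂n₂={z}∆{t}} w w 𝟙_E ≤ tanh(β/2)^{-(k+l)} ∑ 𝟙{∂n₁=∅}𝟙{∂n₂=∅} w w 𝟙_E`. [cite: AizenmanDuminilCopinSidoraviciusCMP2015, §3.2, eqs. (3.8)–(3.9)] -/
theorem tsum_pairWeight_mul_indicator_le_of_walks {β : ℝ} (hβ : 0 < β) {x y z t : V}
    (p : G.Walk x y) (q : G.Walk z t) {E : Set (Current G × Current G)}
    (hE : ∀ r r' : Current G × Current G, r.1.traced ⊆ r'.1.traced → r.2.traced ⊆ r'.2.traced →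
      r ∈ E → r' ∈ E) :
    ∑' r : Current G × Current G, pairWeight G β ({x} ∆ {y}) ({z} ∆ {t}) r * E.indicator 1 r ≤
      (Real.tanh (β / 2))⁻¹ ^ (p.length + q.length) *
        ∑' r : Current G × Current G, pairWeight G β ∅ ∅ r * E.indicator 1 r := by
  have hΓ : 0 ≤ (Real.tanh (β / 2))⁻¹ := inv_nonneg.2 (Real.tanh_half_pos hβ).le
  have h₁ := tsum_pairWeight_mul_indicator_le_of_walk G hβ ({x} ∆ {y}) ({z} ∆ {t}) (E := E)
    (fun n₁ n₁' n₂ h h1 => hE (n₁, n₂) (n₁', n₂) h subset_rfl h1) p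
  have h₂ := tsum_pairWeight_mul_indicator_le_of_walk_snd G hβ ∅ ({z} ∆ {t}) (E := E)
    (fun n₁ n₂ n₂' h h1 => hE (n₁, n₂) (n₁, n₂') subset_rfl h h1) q
  rw [symmDiff_self, Finset.bot_eq_empty] at h₁ h₂
  calc ∑' r : Current G × Current G, pairWeight G β ({x} ∆ {y}) ({z} ∆ {t}) r * E.indicator 1 r
      ≤ (Real.tanh (β / 2))⁻¹ ^ p.length *
          ∑' r : Current G × Current G, pairWeight G β ∅ ({z} ∆ {t}) r * E.indicator 1 r := h₁
    _ ≤ (Real.tanh (β / 2))⁻¹ ^ p.length * ((Real.tanh (β / 2))⁻¹ ^ q.length *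
          ∑' r : Current G × Current G, pairWeight G β ∅ ∅ r * E.indicator 1 r) :=
        mul_le_mul_of_nonneg_left h₂ (pow_nonneg hΓ _)
    _ = (Real.tanh (β / 2))⁻¹ ^ (p.length + q.length) *
          ∑' r : Current G × Current G, pairWeight G β ∅ ∅ r * E.indicator 1 r := by
        rw [pow_add]; ring

end InsertionPair

/-! ### Domination of `P^{{x}∆{y},{z}∆{t}}_{Λ_L,β}` by `P^{∅,∅}_{Λ_L,β}` on increasing events -/

section PairDomination

variable (d : ℕ)

/-- The lifted trace of a pair of currents is monotone in each trace. [folklore] -/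
theorem sourcedTrace_mono {L : ℕ} {r r' : Current (freeBoxGraph d L) × Current (freeBoxGraph d L)}
    (h₁ : r.1.traced ⊆ r'.1.traced) (h₂ : r.2.traced ⊆ r'.2.traced) :
    sourcedTrace d L r ⊆ sourcedTrace d L r' := by
  rw [sourcedTrace_eq_union, sourcedTrace_eq_union]
  exact Set.union_subset_union (liftBonds_mono d h₁) (liftBonds_mono d h₂)

/-- `⟨σ_A⟩⁰_{Λ_L;β,0} = Z_{Λ_L}(A)/Z_{Λ_L}(∅)` for `A ⊆ Λ_L` (random-current representation on the free
box graph, `isingCorr_free_box_eq`). [cite: AizenmanDuminilCopinSidoraviciusCMP2015, §2.1, eq. (2.7)] -/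
theorem isingCorr_free_box_eq_currentSum_div (L : ℕ) (β : ℝ) {A : Finset (Site d)} (hA : A ⊆ box d L) :
    isingCorr (zdGraph d) (box d L) β 0 .free A =
      currentSum (freeBoxGraph d L) β (boxSources d L A) / currentSum (freeBoxGraph d L) β ∅ := by
  have h1 := isingCorr_free_box_eq d L β (boxSources_subset_boxCore hA)
  rw [map_boxSources hA] at h1
  rw [h1, plusCurrentSum_freeBoxGraph_eq_currentSum, plusCurrentSum_freeBoxGraph_eq_currentSum]

/-- **Source insertion for `P^{{x}∆{y},{z}∆{t}}_{Λ_L,β}` against `P^{∅,∅}_{Λ_L,β}`** (ADS15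
(3.8)–(3.9) for both currents of ADC21's `P^{xy,zt} = P^{xy} ⊗ P^{zt}`): for `β > 0`, box vertices
`x, y, z, t` of `Λ_L` joined by walks `x ⇝ y`, `z ⇝ t` of lengths `k`, `l` in the free box graph, and
an increasing measurable event `E`,
`P^{{x}∆{y},{z}∆{t}}_{Λ_L,β}[E] · ⟨σ_xσ_y⟩⁰_{Λ_L}⟨σ_zσ_t⟩⁰_{Λ_L} ≤ tanh(β/2)^{-(k+l)} P^{∅,∅}_{Λ_L,β}[E]`. [cite: AizenmanDuminilCopinSidoraviciusCMP2015, §3.2, eqs. (3.8)–(3.9)] [cite: AizenmanDuminilCopinAnnals2021, §3.1] -/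
theorem sourcedDoubleCurrentLaw_pair_real_mul_le {β : ℝ} (hβ : 0 < β) {L : ℕ}
    (x y z t : BoxVertex d L) (hx : (x : Site d) ∈ box d L) (hy : (y : Site d) ∈ box d L)
    (hz : (z : Site d) ∈ box d L) (ht : (t : Site d) ∈ box d L)
    (p : (freeBoxGraph d L).Walk x y) (q : (freeBoxGraph d L).Walk z t)
    {E : Set (BondConfig (Site d))} (hE : IsUpperSet E) (hEm : MeasurableSet E) :
    (sourcedDoubleCurrentLaw d L β ({(x : Site d)} ∆ {(y : Site d)}) ({(z : Site d)} ∆ {(t : Site d)})).real E *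
        (isingCorr (zdGraph d) (box d L) β 0 .free ({(x : Site d)} ∆ {(y : Site d)}) *
          isingCorr (zdGraph d) (box d L) β 0 .free ({(z : Site d)} ∆ {(t : Site d)})) ≤
      (Real.tanh (β / 2))⁻¹ ^ (p.length + q.length) * (sourcedDoubleCurrentLaw d L β ∅ ∅).real E := by
  classical
  have hA : boxSources d L ({(x : Site d)} ∆ {(y : Site d)}) = ({x} : Finset (BoxVertex d L)) ∆ {y} :=
    boxSources_pair d L x y
  have hB : boxSources d L ({(z : Site d)} ∆ {(t : Site d)}) = ({z} : Finset (BoxVertex d L)) ∆ {t} :=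
    boxSources_pair d L z t
  -- the event read on pairs of currents; increasing in both traces
  set E' : Set (Current (freeBoxGraph d L) × Current (freeBoxGraph d L)) := sourcedTrace d L ⁻¹' E with hE'
  have hE'meas : MeasurableSet E' := (Set.to_countable _).measurableSet
  have hE'up : ∀ r r' : Current (freeBoxGraph d L) × Current (freeBoxGraph d L), r.1.traced ⊆ r'.1.traced → r.2.traced ⊆ r'.2.traced →
      r ∈ E' → r' ∈ E' := fun r r' h₁ h₂ hr => hE (sourcedTrace_mono d h₁ h₂) hr
  have key := tsum_pairWeight_mul_indicator_le_of_walks (freeBoxGraph d L) hβ p q hE'up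
  -- the series are the measures times the normalisers
  have hser : ∀ A' B' : Finset (BoxVertex d L), ∑' r, pairWeight (freeBoxGraph d L) β A' B' r * E'.indicator 1 r =
      (doubleCurrentMeasure (freeBoxGraph d L) β A' B').real E' * (currentSum (freeBoxGraph d L) β A' * currentSum (freeBoxGraph d L) β B') :=
    fun A' B' => (doubleCurrentMeasure_real_mul' (freeBoxGraph d L) hβ.le A' B' hE'meas).symm
  rw [hser, hser] at key
  have hP : (sourcedDoubleCurrentLaw d L β ({(x : Site d)} ∆ {(y : Site d)}) ({(z : Site d)} ∆ {(t : Site d)})).real E =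
      (doubleCurrentMeasure (freeBoxGraph d L) β ({x} ∆ {y}) ({z} ∆ {t})).real E' := by
    rw [measureReal_def, measureReal_def, sourcedDoubleCurrentLaw_apply L β _ _ hEm, hA, hB]
  have hQ : (sourcedDoubleCurrentLaw d L β ∅ ∅).real E = (doubleCurrentMeasure (freeBoxGraph d L) β ∅ ∅).real E' := by
    rw [measureReal_def, measureReal_def, sourcedDoubleCurrentLaw_apply L β _ _ hEm, boxSources_empty]
  have hcA : isingCorr (zdGraph d) (box d L) β 0 .free ({(x : Site d)} ∆ {(y : Site d)}) =
      currentSum (freeBoxGraph d L) β ({x} ∆ {y}) / currentSum (freeBoxGraph d L) β ∅ := by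
    rw [isingCorr_free_box_eq_currentSum_div d L β (symmDiff_singleton_subset_box d hx hy), hA]
  have hcB : isingCorr (zdGraph d) (box d L) β 0 .free ({(z : Site d)} ∆ {(t : Site d)}) =
      currentSum (freeBoxGraph d L) β ({z} ∆ {t}) / currentSum (freeBoxGraph d L) β ∅ := by
    rw [isingCorr_free_box_eq_currentSum_div d L β (symmDiff_singleton_subset_box d hz ht), hB]
  have hZ0 : 0 < currentSum (freeBoxGraph d L) β ∅ := currentSum_empty_pos' (freeBoxGraph d L) β
  rw [hP, hQ, hcA, hcB]
  generalize (doubleCurrentMeasure (freeBoxGraph d L) β ({x} ∆ {y}) ({z} ∆ {t})).real E' = P at key ⊢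
  generalize (doubleCurrentMeasure (freeBoxGraph d L) β ∅ ∅).real E' = Q at key ⊢
  generalize currentSum (freeBoxGraph d L) β ({x} ∆ {y}) = ZA at key ⊢
  generalize currentSum (freeBoxGraph d L) β ({z} ∆ {t}) = ZB at key ⊢
  generalize currentSum (freeBoxGraph d L) β ∅ = Z₀ at key hZ0 ⊢
  generalize (Real.tanh (β / 2))⁻¹ ^ (p.length + q.length) = Γ at key ⊢
  have hZ₀' : Z₀ * Z₀ ≠ 0 := by positivity
  calc P * (ZA / Z₀ * (ZB / Z₀)) = P * (ZA * ZB) / (Z₀ * Z₀) := by field_simp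
    _ ≤ Γ * (Q * (Z₀ * Z₀)) / (Z₀ * Z₀) := div_le_div_of_nonneg_right key (by positivity)
    _ = Γ * Q := by field_simp

/-- **Uniform source insertion for `P^{{x}∆{y},{z}∆{t}}_{Λ_L,β}`**: for `β > 0` and sites
`x, y, z, t` there are `C ≥ 0` and `L₀` with `P^{{x}∆{y},{z}∆{t}}_{Λ_L,β}[E] ≤ C · P^{∅,∅}_{Λ_L,β}[E]`
for all `L ≥ L₀` and all increasing measurable events `E` (walks of bounded length inside `Λ_{L₀}`,
`exists_walk_freeBoxGraph_length_le`; the box pair correlations are positive and nondecreasing in the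
volume). [cite: AizenmanDuminilCopinSidoraviciusCMP2015, §3.2, eqs. (3.8)–(3.9)] [cite: AizenmanDuminilCopinAnnals2021, §3.1] -/
theorem exists_sourcedDoubleCurrentLaw_pair_real_le_empty {β : ℝ} (hβ : 0 < β) (x y z t : Site d) :
    ∃ C : ℝ, ∃ L₀ : ℕ, 0 ≤ C ∧ ∀ L, L₀ ≤ L → ∀ E : Set (BondConfig (Site d)), MeasurableSet E →
      IsUpperSet E →
        (sourcedDoubleCurrentLaw d L β ({x} ∆ {y}) ({z} ∆ {t})).real E ≤
          C * (sourcedDoubleCurrentLaw d L β ∅ ∅).real E := by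
  obtain ⟨L₀, hL₀⟩ := exists_forall_subset_box d ({x, y, z, t} : Finset (Site d))
  obtain ⟨M, hM⟩ := exists_walk_freeBoxGraph_length_le d L₀
  have hmem : ∀ L, L₀ ≤ L → x ∈ box d L ∧ y ∈ box d L ∧ z ∈ box d L ∧ t ∈ box d L := by
    intro L hL
    have h := hL₀ L hL
    exact ⟨h (by simp), h (by simp), h (by simp), h (by simp)⟩
  obtain ⟨hx₀, hy₀, hz₀, ht₀⟩ := hmem L₀ le_rfl
  have hcApos : 0 < isingCorr (zdGraph d) (box d L₀) β 0 .free ({x} ∆ {y}) :=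
    isingCorr_free_box_pos d hβ (symmDiff_singleton_subset_box d hx₀ hy₀) (even_card_singleton_symmDiff x y)
  have hcBpos : 0 < isingCorr (zdGraph d) (box d L₀) β 0 .free ({z} ∆ {t}) :=
    isingCorr_free_box_pos d hβ (symmDiff_singleton_subset_box d hz₀ ht₀) (even_card_singleton_symmDiff z t)
  set c := (Real.tanh (β / 2))⁻¹ with hc
  have hc1 : 1 ≤ c := one_le_inv_tanh_half hβ
  have hΓ0 : 0 ≤ c ^ (M + M) := pow_nonneg (zero_le_one.trans hc1) _
  refine ⟨c ^ (M + M) /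
      (isingCorr (zdGraph d) (box d L₀) β 0 .free ({x} ∆ {y}) *
        isingCorr (zdGraph d) (box d L₀) β 0 .free ({z} ∆ {t})), L₀,
    div_nonneg hΓ0 (mul_pos hcApos hcBpos).le, fun L hL E hEm hE => ?_⟩
  obtain ⟨hx, hy, hz, ht⟩ := hmem L hL
  set x' : BoxVertex d L := ⟨x, box_subset_box_succ d L hx⟩ with hx'
  set y' : BoxVertex d L := ⟨y, box_subset_box_succ d L hy⟩ with hy'
  set z' : BoxVertex d L := ⟨z, box_subset_box_succ d L hz⟩ with hz'
  set t' : BoxVertex d L := ⟨t, box_subset_box_succ d L ht⟩ with ht'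
  obtain ⟨p, hp⟩ := hM L hL x' y' hx₀ hy₀
  obtain ⟨q, hq⟩ := hM L hL z' t' hz₀ ht₀
  have hmonA : isingCorr (zdGraph d) (box d L₀) β 0 .free ({x} ∆ {y}) ≤
      isingCorr (zdGraph d) (box d L) β 0 .free ({x} ∆ {y}) :=
    isingCorr_free_le_of_subset (zdGraph d) hβ.le le_rfl (symmDiff_singleton_subset_box d hx₀ hy₀) (box_mono d hL)
  have hmonB : isingCorr (zdGraph d) (box d L₀) β 0 .free ({z} ∆ {t}) ≤
      isingCorr (zdGraph d) (box d L) β 0 .free ({z} ∆ {t}) :=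
    isingCorr_free_le_of_subset (zdGraph d) hβ.le le_rfl (symmDiff_singleton_subset_box d hz₀ ht₀) (box_mono d hL)
  have h : (sourcedDoubleCurrentLaw d L β ({x} ∆ {y}) ({z} ∆ {t})).real E *
      (isingCorr (zdGraph d) (box d L) β 0 .free ({x} ∆ {y}) *
        isingCorr (zdGraph d) (box d L) β 0 .free ({z} ∆ {t})) ≤
      c ^ (p.length + q.length) * (sourcedDoubleCurrentLaw d L β ∅ ∅).real E :=
    sourcedDoubleCurrentLaw_pair_real_mul_le d hβ x' y' z' t' hx hy hz ht p q hE hEm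
  have hQ : 0 ≤ (sourcedDoubleCurrentLaw d L β ∅ ∅).real E := measureReal_nonneg
  have hpow : c ^ (p.length + q.length) ≤ c ^ (M + M) := pow_le_pow_right₀ hc1 (Nat.add_le_add hp hq)
  have h' : (sourcedDoubleCurrentLaw d L β ({x} ∆ {y}) ({z} ∆ {t})).real E *
      (isingCorr (zdGraph d) (box d L) β 0 .free ({x} ∆ {y}) *
        isingCorr (zdGraph d) (box d L) β 0 .free ({z} ∆ {t})) ≤
      c ^ (M + M) * (sourcedDoubleCurrentLaw d L β ∅ ∅).real E :=
    h.trans (mul_le_mul_of_nonneg_right hpow hQ)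
  generalize (sourcedDoubleCurrentLaw d L β ({x} ∆ {y}) ({z} ∆ {t})).real E = P at h' ⊢
  generalize (sourcedDoubleCurrentLaw d L β ∅ ∅).real E = Q at h' hQ ⊢
  generalize isingCorr (zdGraph d) (box d L) β 0 .free ({x} ∆ {y}) = a at h' hmonA ⊢
  generalize isingCorr (zdGraph d) (box d L) β 0 .free ({z} ∆ {t}) = b at h' hmonB ⊢
  generalize isingCorr (zdGraph d) (box d L₀) β 0 .free ({x} ∆ {y}) = cA at hcApos hmonA ⊢
  generalize isingCorr (zdGraph d) (box d L₀) β 0 .free ({z} ∆ {t}) = cB at hcBpos hmonB ⊢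
  generalize c ^ (M + M) = Γ at h' hΓ0 ⊢
  have ha : 0 < a := hcApos.trans_le hmonA
  have hb : 0 < b := hcBpos.trans_le hmonB
  calc P = P * (a * b) / (a * b) := by field_simp
    _ ≤ Γ * Q / (a * b) := div_le_div_of_nonneg_right h' (by positivity)
    _ ≤ Γ * Q / (cA * cB) :=
        div_le_div_of_nonneg_left (by positivity) (by positivity) (mul_le_mul hmonA hmonB hcBpos.le ha.le)
    _ = Γ / (cA * cB) * Q := by ring

end PairDomination

/-! ### No percolation of the sourced infinite-volume double current, and `P_L[x ↔ z] → P_β[x ↔ z]` -/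

section PairLimit

variable (d : ℕ)

/-- `exitBoxEvent x N` is an increasing event. [folklore] -/
theorem isUpperSet_exitBoxEvent (x : Site d) (N : ℕ) : IsUpperSet (exitBoxEvent d x N) := by
  rintro ω ω' hle ⟨v, hv, hreach⟩
  exact ⟨v, hv, hreach.mono (openGraph_mono (Set.inter_subset_inter_left _ hle))⟩

/-- A non-lattice pair is never open under `P^{A,B}_{Λ_L,β}`. [folklore] -/
theorem sourcedDoubleCurrentLaw_real_setOf_mem_eq_zero (L : ℕ) (β : ℝ) (A B : Finset (Site d))
    {e : Sym2 (Site d)} (he : e ∉ (zdGraph d).edgeSet) :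
    (sourcedDoubleCurrentLaw d L β A B).real {ω : BondConfig (Site d) | e ∈ ω} = 0 := by
  rw [← measureReal_empty (μ := sourcedDoubleCurrentLaw d L β A B)]
  refine sourcedDoubleCurrentLaw_real_congr_lattice d L β A B (measurableSet_mem e) MeasurableSet.empty
    fun ω hω => ?_
  simp only [Set.mem_setOf_eq, Set.mem_empty_iff_false, iff_false]
  exact fun heω => he (hω heω)

variable {d} in
/-- **`P^{A,B}_β`-almost every configuration consists of lattice bonds** (the finite-volume laws
charge only traces of box currents). [folklore] -/
theorem IsSourcedDoubleCurrentLimit.ae_subset_edgeSet {β : ℝ} {A B : Finset (Site d)}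
    {μ : Measure (BondConfig (Site d))} (hμ : IsSourcedDoubleCurrentLimit d β A B μ) :
    ∀ᵐ ω ∂μ, ω ⊆ (zdGraph d).edgeSet := by
  haveI := hμ.isProbabilityMeasure
  have h0 : ∀ e : Sym2 (Site d), e ∉ (zdGraph d).edgeSet → μ {ω | e ∈ ω} = 0 := by
    intro e he
    have ht := hμ.tendsto_local {ω | e ∈ ω} (isLocalEvent_setOf_mem e)
    have hc : Tendsto (fun _ : ℕ => (0 : ℝ)) atTop (𝓝 (μ.real {ω | e ∈ ω})) :=
      ht.congr fun L => sourcedDoubleCurrentLaw_real_setOf_mem_eq_zero d L β A B he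
    have h := tendsto_nhds_unique hc tendsto_const_nhds
    exact (measureReal_eq_zero_iff (measure_ne_top μ _)).1 h
  have hset : {ω : BondConfig (Site d) | ¬ω ⊆ (zdGraph d).edgeSet} =
      ⋃ e ∈ ((zdGraph d).edgeSet)ᶜ, {ω | e ∈ ω} := by
    ext ω
    simp only [Set.mem_setOf_eq, Set.not_subset, Set.mem_iUnion, Set.mem_compl_iff, exists_prop]
    exact ⟨fun ⟨e, heω, he⟩ => ⟨e, he, heω⟩, fun ⟨e, he, heω⟩ => ⟨e, heω, he⟩⟩
  rw [ae_iff, hset]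
  exact (measure_biUnion_null_iff (Set.to_countable _)).2 fun e he => h0 e he

/-- **No percolation of the infinite-volume sourced double current `P^{{x}∆{y},{z}∆{t}}_β`**
(ADC21 §3.2, footnote 5: "for `β ≤ β_c` … `n₁+n₂` does not contain infinite paths of positive
currents, almost surely under `P^{A,B}_β`"), in the form `P_β[v` connected to distance `N] → 0`
(`d ≥ 2`, `0 < β ≤ β_c(d)`, every site `v`): by the uniform source insertion
(`exists_sourcedDoubleCurrentLaw_pair_real_le_empty`) passed to the limit on the local events
`exitBoxEvent v N`, `P_β[⋯] ≤ C · P^{∅,∅}_β[⋯] → 0` (`tendsto_sourcedDoubleCurrentLawInf_empty_real_exitBoxEvent`). [cite: AizenmanDuminilCopinAnnals2021, §3.2, footnote 5] -/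
theorem tendsto_sourcedDoubleCurrentLawInf_pair_real_exitBoxEvent (hd : 2 ≤ d) {β : ℝ} (hβ : 0 < β)
    (hβc : β ≤ criticalBeta d) (x y z t v : Site d) :
    Tendsto (fun N : ℕ => (sourcedDoubleCurrentLawInf d β ({x} ∆ {y}) ({z} ∆ {t})).real (exitBoxEvent d v N))
      atTop (𝓝 0) := by
  have hA : Even #(({x} : Finset (Site d)) ∆ {y}) := even_card_singleton_symmDiff x y
  have hB : Even #(({z} : Finset (Site d)) ∆ {t}) := even_card_singleton_symmDiff z t
  have hlimP := isSourcedDoubleCurrentLimit_lawInf (exists_isSourcedDoubleCurrentLimit d hβ hA hB)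
  have hlimQ := isSourcedDoubleCurrentLimit_lawInf
    (exists_isSourcedDoubleCurrentLimit d hβ (A := ∅) (B := ∅) (by simp) (by simp))
  obtain ⟨C, L₀, hC, hdom⟩ := exists_sourcedDoubleCurrentLaw_pair_real_le_empty d hβ x y z t
  have hN : ∀ N, (sourcedDoubleCurrentLawInf d β ({x} ∆ {y}) ({z} ∆ {t})).real (exitBoxEvent d v N) ≤
      C * (sourcedDoubleCurrentLawInf d β ∅ ∅).real (exitBoxEvent d v N) := by
    intro N
    refine le_of_tendsto_of_tendsto (hlimP.tendsto_local _ (isLocalEvent_exitBoxEvent d v N))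
      ((hlimQ.tendsto_local _ (isLocalEvent_exitBoxEvent d v N)).const_mul C) ?_
    filter_upwards [eventually_ge_atTop L₀] with L hL
    exact hdom L hL _ (measurableSet_exitBoxEvent d v N) (isUpperSet_exitBoxEvent d v N)
  have h0 := (tendsto_sourcedDoubleCurrentLawInf_empty_real_exitBoxEvent d hd hβ hβc v).const_mul C
  rw [mul_zero] at h0
  exact squeeze_zero (fun N => measureReal_nonneg) hN h0

/-- **Squeezing a non-local probability between local ones**: if `c_N(L) ≤ p(L) ≤ c_N(L) + b_N(L)`
for `L` large, `c_N(L) → c_N`, `b_N(L) → b_N` as `L → ∞`, and `c_N → l`, `b_N → 0` as `N → ∞`,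
then `p(L) → l`. [folklore] -/
theorem tendsto_of_local_sandwich {p : ℕ → ℝ} {c b : ℕ → ℕ → ℝ} {c' b' : ℕ → ℝ} {l : ℝ}
    (hlow : ∀ N, ∀ᶠ L in atTop, c N L ≤ p L) (hup : ∀ N, ∀ᶠ L in atTop, p L ≤ c N L + b N L)
    (hc : ∀ N, Tendsto (c N) atTop (𝓝 (c' N))) (hb : ∀ N, Tendsto (b N) atTop (𝓝 (b' N)))
    (hc' : Tendsto c' atTop (𝓝 l)) (hb' : Tendsto b' atTop (𝓝 0)) : Tendsto p atTop (𝓝 l) := by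
  rw [tendsto_order]
  constructor
  · intro a ha
    obtain ⟨N, hN⟩ := ((tendsto_order.1 hc').1 a ha).exists
    filter_upwards [hlow N, (tendsto_order.1 (hc N)).1 a hN] with L h1 h2
    exact h2.trans_le h1
  · intro a ha
    have h : Tendsto (fun N => c' N + b' N) atTop (𝓝 (l + 0)) := hc'.add hb'
    rw [add_zero] at h
    obtain ⟨N, hN⟩ := ((tendsto_order.1 h).2 a ha).exists
    filter_upwards [hup N, (tendsto_order.1 ((hc N).add (hb N))).2 a hN] with L h1 h2
    exact h1.trans_lt h2

/-- The constrained connection event is contained in the connection event. [folklore] -/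
theorem openConnVia_subset_openConn {V : Type*} (K : SimpleGraph V) (x z : V) :
    openConnVia K x z ⊆ (openConn x z : Set (BondConfig V)) := fun ω hω => by
  rw [openConnVia_eq_preimage] at hω
  exact isUpperSet_openConn x z Set.inter_subset_left hω

/-- **Exhausting `{x ↔ z}` by boxes, up to exits**: on lattice configurations, if `x ↔ z` then
either `x ↔ z` inside `x + Λ_N`, or `x` is connected to distance `N` (stop an open path at its
first vertex outside `x + Λ_N`). [cite: AizenmanDuminilCopinSidoraviciusCMP2015, §3.2, remark after (3.11)] -/
theorem openConn_subset_openConnVia_union_exitBoxEvent {x z : Site d} {N : ℕ}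
    {ω : BondConfig (Site d)} (hω : ω ⊆ (zdGraph d).edgeSet)
    (h : ω ∈ (openConn x z : Set (BondConfig (Site d)))) :
    ω ∈ openConnVia (withinGraph (zdGraph d) ↑(shiftedBox x N)) x z ∪ exitBoxEvent d x N := by
  classical
  obtain ⟨p⟩ := h
  by_cases hs : ∀ v ∈ p.support, v ∈ shiftedBox x N
  · exact Or.inl ((mem_openConnVia_withinGraph_iff d).2
      (reachable_inter_edgesIn_of_walk d hω (shiftedBox x N) p hs))
  · push Not at hs
    obtain ⟨v, hv, hvN⟩ := hs
    have hxv : (openGraph ω).Reachable x v := ⟨p.takeUntil v hv⟩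
    have hx : x ∈ shiftedBox x N := mem_shiftedBox_iff.2 (by rw [sub_self]; exact zero_mem_box d N)
    obtain ⟨u, hu, hxu⟩ := exists_reachable_inter_edgesTouching (zdGraph d) (shiftedBox x N) hω hx hvN hxv
    exact Or.inr ⟨u, hu, hxu⟩

variable {d} in
/-- Monotonicity of `P^{A,B}_{Λ_L,β}` along inclusions valid on lattice configurations. [folklore] -/
theorem sourcedDoubleCurrentLaw_real_mono_lattice (L : ℕ) (β : ℝ) (A B : Finset (Site d))
    [IsFiniteMeasure (sourcedDoubleCurrentLaw d L β A B)]
    {S S' : Set (BondConfig (Site d))} (hS : MeasurableSet S) (hS' : MeasurableSet S')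
    (h : ∀ ω : BondConfig (Site d), ω ⊆ (zdGraph d).edgeSet → ω ∈ S → ω ∈ S') :
    (sourcedDoubleCurrentLaw d L β A B).real S ≤ (sourcedDoubleCurrentLaw d L β A B).real S' := by
  have hne : sourcedDoubleCurrentLaw d L β A B S' ≠ ∞ := measure_ne_top _ _
  rw [sourcedDoubleCurrentLaw_apply L β A B hS'] at hne
  rw [measureReal_def, measureReal_def, sourcedDoubleCurrentLaw_apply L β A B hS,
    sourcedDoubleCurrentLaw_apply L β A B hS']
  exact ENNReal.toReal_mono hne (measure_mono fun pr hpr => h _ (sourcedTrace_subset_edgeSet d L pr) hpr)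

/-- **`P^{{x}∆{y},{z}∆{t}}_{Λ_L,β}[x ↔ z] → P^{{x}∆{y},{z}∆{t}}_β[x ↔ z]`** for `d ≥ 2` and
`0 < β ≤ β_c(d)` — the passage to the limit on the non-local increasing event `{x ↔ z}` (ADC21
§3.2 with footnote 5): `{x ↔ z}` is squeezed between the local events `{x ↔ z inside x + Λ_N}` and
`{x ↔ z inside x + Λ_N} ∪ {x connected to distance N}`, whose limiting probabilities tend, as
`N → ∞`, to `P_β[x ↔ z]` (continuity from below, a.e. configuration being a lattice configuration)
and to `P_β[x ↔ z] + 0` (`tendsto_sourcedDoubleCurrentLawInf_pair_real_exitBoxEvent`). [cite: AizenmanDuminilCopinAnnals2021, §3.2, footnote 5] -/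
theorem tendsto_sourcedDoubleCurrentLaw_real_openConn (hd : 2 ≤ d) {β : ℝ} (hβ : 0 < β)
    (hβc : β ≤ criticalBeta d) (x y z t : Site d) :
    Tendsto (fun L : ℕ => (sourcedDoubleCurrentLaw d L β ({x} ∆ {y}) ({z} ∆ {t})).real (openConn x z))
      atTop (𝓝 ((sourcedDoubleCurrentLawInf d β ({x} ∆ {y}) ({z} ∆ {t})).real (openConn x z))) := by
  have hA : Even #(({x} : Finset (Site d)) ∆ {y}) := even_card_singleton_symmDiff x y
  have hB : Even #(({z} : Finset (Site d)) ∆ {t}) := even_card_singleton_symmDiff z t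
  have hlimP := isSourcedDoubleCurrentLimit_lawInf (exists_isSourcedDoubleCurrentLimit d hβ hA hB)
  set P := sourcedDoubleCurrentLawInf d β ({x} ∆ {y}) ({z} ∆ {t}) with hPdef
  haveI := hlimP.isProbabilityMeasure
  set C : ℕ → Set (BondConfig (Site d)) := fun N =>
    openConnVia (withinGraph (zdGraph d) ↑(shiftedBox x N)) x z with hC
  -- the finite-volume laws are probability measures for `L ≥ L₀`
  obtain ⟨L₀, hL₀⟩ := exists_forall_subset_box d ((({x} : Finset (Site d)) ∆ {y}) ∪ ({z} ∆ {t}))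
  have hprob : ∀ L, L₀ ≤ L →
      IsProbabilityMeasure (sourcedDoubleCurrentLaw d L β ({x} ∆ {y}) ({z} ∆ {t})) := by
    intro L hL
    exact isProbabilityMeasure_sourcedDoubleCurrentLaw hβ.le
      (currentSum_boxSources_pos d hβ (Finset.subset_union_left.trans (hL₀ L hL)) hA).ne'
      (currentSum_boxSources_pos d hβ (Finset.subset_union_right.trans (hL₀ L hL)) hB).ne'
  refine tendsto_of_local_sandwich
    (c := fun N L => (sourcedDoubleCurrentLaw d L β ({x} ∆ {y}) ({z} ∆ {t})).real (C N))
    (b := fun N L => (sourcedDoubleCurrentLaw d L β ({x} ∆ {y}) ({z} ∆ {t})).real (exitBoxEvent d x N))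
    (c' := fun N => P.real (C N)) (b' := fun N => P.real (exitBoxEvent d x N)) ?_ ?_ ?_ ?_ ?_ ?_
  · intro N
    filter_upwards [eventually_ge_atTop L₀] with L hL
    haveI := hprob L hL
    exact measureReal_mono (openConnVia_subset_openConn _ x z) (measure_ne_top _ _)
  · intro N
    filter_upwards [eventually_ge_atTop L₀] with L hL
    haveI := hprob L hL
    calc (sourcedDoubleCurrentLaw d L β ({x} ∆ {y}) ({z} ∆ {t})).real (openConn x z)
        ≤ (sourcedDoubleCurrentLaw d L β ({x} ∆ {y}) ({z} ∆ {t})).real (C N ∪ exitBoxEvent d x N) :=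
          sourcedDoubleCurrentLaw_real_mono_lattice L β _ _ (measurableSet_openConn_holds x z)
            ((measurableSet_openConnVia _ x z).union (measurableSet_exitBoxEvent d x N))
            fun ω hω h => openConn_subset_openConnVia_union_exitBoxEvent d hω h
      _ ≤ (sourcedDoubleCurrentLaw d L β ({x} ∆ {y}) ({z} ∆ {t})).real (C N) +
            (sourcedDoubleCurrentLaw d L β ({x} ∆ {y}) ({z} ∆ {t})).real (exitBoxEvent d x N) :=
          measureReal_union_le _ _
  · intro N
    exact hlimP.tendsto_local _ (isLocalEvent_openConnVia_shiftedBox d x N z)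
  · intro N
    exact hlimP.tendsto_local _ (isLocalEvent_exitBoxEvent d x N)
  · -- `P[x ↔ z inside x + Λ_N] ↑ P[x ↔ z]`
    have hmono : Monotone C := openConnVia_shiftedBox_mono d x z
    have h1 : Tendsto (fun N => P.real (C N)) atTop (𝓝 (P.real (⋃ N, C N))) :=
      (ENNReal.tendsto_toReal (measure_ne_top _ _)).comp (tendsto_measure_iUnion_atTop hmono)
    have hnull : P {ω : BondConfig (Site d) | ¬ω ⊆ (zdGraph d).edgeSet} = 0 := by
      have h := hlimP.ae_subset_edgeSet
      rw [ae_iff] at h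
      exact h
    have heq : P.real (⋃ N, C N) = P.real (openConn x z) := by
      apply le_antisymm
      · exact measureReal_mono (Set.iUnion_subset fun N => openConnVia_subset_openConn _ x z)
          (measure_ne_top _ _)
      · calc P.real (openConn x z)
            ≤ P.real ((⋃ N, C N) ∪ {ω : BondConfig (Site d) | ¬ω ⊆ (zdGraph d).edgeSet}) := by
              refine measureReal_mono (fun ω hω => ?_) (measure_ne_top _ _)
              by_cases h : ω ⊆ (zdGraph d).edgeSet
              · exact Or.inl (openConn_subset_iUnion_openConnVia_shiftedBox d h hω)
              · exact Or.inr h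
          _ ≤ P.real (⋃ N, C N) + P.real {ω : BondConfig (Site d) | ¬ω ⊆ (zdGraph d).edgeSet} :=
              measureReal_union_le _ _
          _ = P.real (⋃ N, C N) := by
              rw [show P.real {ω : BondConfig (Site d) | ¬ω ⊆ (zdGraph d).edgeSet} = 0 from by
                rw [measureReal_def, hnull, ENNReal.toReal_zero], add_zero]
    rw [← heq]
    exact h1
  · exact tendsto_sourcedDoubleCurrentLawInf_pair_real_exitBoxEvent d hd hβ hβc x y z t x

end PairLimit

/-! ### The case `β = 0` for pair sources -/

section BetaZeroPair

variable {V : Type*} [Fintype V] [DecidableEq V] (G : SimpleGraph V) [DecidableRel G.Adj]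

/-- If no current has the prescribed sources, the double-current measure is the junk `0`. [folklore] -/
theorem doubleCurrentMeasure_eq_zero_of_currentSum {β : ℝ} {A B : Finset V}
    (h : currentSum G β A * currentSum G β B = 0) : doubleCurrentMeasure G β A B = 0 := by
  rw [doubleCurrentMeasure]
  have hf : (fun p : Current G × Current G =>
      ENNReal.ofReal (pairWeight G β A B p / (currentSum G β A * currentSum G β B)) • Measure.dirac p) =
      fun _ => 0 := by
    funext p
    rw [h, div_zero, ENNReal.ofReal_zero, zero_smul]
  rw [hf, Measure.sum_zero]

variable (d : ℕ)

/-- **At `β = 0` a box current with a pair of distinct sources does not exist**: for `x ≠ y`,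
`x ∈ Λ_L`, `Z_{Λ_L,0}({x}∆{y}) = 0`. [folklore] -/
theorem currentSum_zero_beta_boxSources_pair {L : ℕ} {x y : Site d} (hxy : x ≠ y) (hx : x ∈ box d L) :
    currentSum (freeBoxGraph d L) 0 (boxSources d L ({x} ∆ {y})) = 0 := by
  have hne : boxSources d L (({x} : Finset (Site d)) ∆ {y}) ≠ ∅ := by
    refine Finset.ne_empty_of_mem (a := (⟨x, box_subset_box_succ d L hx⟩ : BoxVertex d L)) ?_
    rw [mem_boxSources_iff, Finset.mem_symmDiff]
    exact Or.inl ⟨Finset.mem_singleton_self x, fun h => hxy (Finset.mem_singleton.1 h)⟩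
  rw [currentSum_zero_beta, if_neg hne]

/-- At `β = 0` the sourced box laws with a pair of distinct sources (in either current) are the junk
`0`: every event has probability `0`. [folklore] -/
theorem sourcedDoubleCurrentLaw_zero_beta_real_eq_zero_of_ne {L : ℕ} {x y : Site d} (hxy : x ≠ y)
    (hx : x ∈ box d L) (B : Finset (Site d)) (S : Set (BondConfig (Site d))) :
    (sourcedDoubleCurrentLaw d L 0 ({x} ∆ {y}) B).real S = 0 ∧
      (sourcedDoubleCurrentLaw d L 0 B ({x} ∆ {y})).real S = 0 := by
  have hZ := currentSum_zero_beta_boxSources_pair d hxy hx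
  constructor
  · rw [sourcedDoubleCurrentLaw, doubleCurrentMeasure_eq_zero_of_currentSum _ (by rw [hZ, zero_mul]),
      Measure.map_zero, measureReal_def, Measure.coe_zero, Pi.zero_apply, ENNReal.toReal_zero]
  · rw [sourcedDoubleCurrentLaw, doubleCurrentMeasure_eq_zero_of_currentSum _ (by rw [hZ, mul_zero]),
      Measure.map_zero, measureReal_def, Measure.coe_zero, Pi.zero_apply, ENNReal.toReal_zero]

/-- At `β = 0` the free pair expectation of distinct sites vanishes (`freeCorr_zero_beta`). [folklore] -/
theorem freeExpect_zero_beta_spinMonomial_two {x y : Site d} (hxy : x ≠ y) :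
    freeExpect d 0 0 (spinMonomial ![x, y]) = 0 := by
  rw [freeExpect_spinMonomial_two_eq_freeCorr, freeCorr_zero_beta, if_neg]
  refine Finset.ne_empty_of_mem (a := x) ?_
  rw [Finset.mem_symmDiff]
  exact Or.inl ⟨Finset.mem_singleton_self x, fun h => hxy (Finset.mem_singleton.1 h)⟩

end BetaZeroPair

/-! ### Assembly: ADC21 (3.11) in infinite volume -/

section UrsellAssembly

variable (d : ℕ)

/-- `⟨σ_uσ_v⟩⁰_{Λ;β,0} = ⟨σ_{{u}∆{v}}⟩⁰_{Λ;β,0}`. [folklore] -/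
theorem isingTwoPoint_free_eq_isingCorr_symmDiff (Λ : Finset (Site d)) (β : ℝ) (u v : Site d) :
    isingTwoPoint (zdGraph d) Λ β 0 .free u v = isingCorr (zdGraph d) Λ β 0 .free ({u} ∆ {v}) := by
  simp only [isingTwoPoint, isingCorr, spinPair_eq_spinProduct_symmDiff]

/-- The box pair correlations converge to the free state on the pair monomial (`β ≥ 0`). [cite: FriedliVelenik2017, Exercise 3.16] -/
theorem tendsto_isingTwoPoint_free_box {β : ℝ} (hβ : 0 ≤ β) (u v : Site d) :
    Tendsto (fun L : ℕ => isingTwoPoint (zdGraph d) (box d L) β 0 .free u v) atTop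
      (𝓝 (freeExpect d β 0 (spinMonomial ![u, v]))) := by
  rw [freeExpect_spinMonomial_two_eq_freeCorr]
  simp_rw [isingTwoPoint_free_eq_isingCorr_symmDiff]
  exact hasBoxLimit_isingCorr_free_holds hβ le_rfl _

/-- The box four-point functions converge to the free state on the four-point monomial (`β ≥ 0`). [cite: FriedliVelenik2017, Exercise 3.16] -/
theorem tendsto_isingExpect_free_box_spinMonomial_four {β : ℝ} (hβ : 0 ≤ β) (x y z t : Site d) :
    Tendsto (fun L : ℕ => isingExpect (zdGraph d) (box d L) β 0 .free (spinMonomial ![x, y, z, t])) atTop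
      (𝓝 (freeExpect d β 0 (spinMonomial ![x, y, z, t]))) := by
  rw [spinMonomial_four_eq_spinProduct]
  exact hasBoxLimit_isingCorr_free_holds hβ le_rfl _

/-- **(3.11) in infinite volume from the convergence of the connection probability**: for `β ≥ 0`,
if `P^{{x}∆{y},{z}∆{t}}_{Λ_L,β}[x ↔ z] → p`, then `U₄(x,y,z,t) = -2⟨σ_xσ_y⟩_β⟨σ_zσ_t⟩_β · p` — the
`L → ∞` limit of the box identities `connectedFour_free_box_eq`, all spin expectations converging by
the existence of the free state. [cite: AizenmanDuminilCopinAnnals2021, eq. (3.11)] -/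
theorem freeUrsellFour_eq_of_tendsto {β : ℝ} (hβ : 0 ≤ β) (x y z t : Site d) {p : ℝ}
    (hP : Tendsto (fun L : ℕ =>
      (sourcedDoubleCurrentLaw d L β ({x} ∆ {y}) ({z} ∆ {t})).real (openConn x z)) atTop (𝓝 p)) :
    freeExpect d β 0 (spinMonomial ![x, y, z, t]) -
        (freeExpect d β 0 (spinMonomial ![x, y]) * freeExpect d β 0 (spinMonomial ![z, t]) +
          freeExpect d β 0 (spinMonomial ![x, z]) * freeExpect d β 0 (spinMonomial ![y, t]) +
          freeExpect d β 0 (spinMonomial ![x, t]) * freeExpect d β 0 (spinMonomial ![y, z])) =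
      -2 * freeExpect d β 0 (spinMonomial ![x, y]) * freeExpect d β 0 (spinMonomial ![z, t]) * p := by
  have h4 := tendsto_isingExpect_free_box_spinMonomial_four d hβ x y z t
  have hxy := tendsto_isingTwoPoint_free_box d hβ x y
  have hzt := tendsto_isingTwoPoint_free_box d hβ z t
  have hxz := tendsto_isingTwoPoint_free_box d hβ x z
  have hyt := tendsto_isingTwoPoint_free_box d hβ y t
  have hxt := tendsto_isingTwoPoint_free_box d hβ x t
  have hyz := tendsto_isingTwoPoint_free_box d hβ y z
  have hL := h4.sub (((hxy.mul hzt).add (hxz.mul hyt)).add (hxt.mul hyz))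
  have hR := ((hxy.const_mul (-2)).mul hzt).mul hP
  refine tendsto_nhds_unique (hL.congr' ?_) hR
  obtain ⟨L₀, hL₀⟩ := exists_forall_subset_box d ({x, y, z, t} : Finset (Site d))
  filter_upwards [eventually_ge_atTop L₀] with L hLge
  have h := hL₀ L hLge
  have hid := connectedFour_free_box_eq d L hβ (x := x) (y := y) (z := z) (t := t)
    (h (by simp)) (h (by simp)) (h (by simp)) (h (by simp))
  simp only [connectedFour, nPoint_isingMeasure, twoPoint_isingMeasure, Matrix.cons_val_zero,
    Matrix.cons_val_one, Matrix.cons_val] at hid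
  linarith

/-- **ADC21 eq. (3.11) in infinite volume, proved**: the discharge of the named fact
`freeUrsellFour_eq_sourcedDoubleCurrent` — for the nearest-neighbour Ising model on `ℤ^d`,
`d ≥ 2`, `0 ≤ β ≤ β_c(d)` and sites `x, y, z, t`,
`U₄^β(x,y,z,t) = -2⟨σ_xσ_y⟩_β⟨σ_zσ_t⟩_β · P^{{x}∆{y},{z}∆{t}}_β[x ↔ z]` (Aizenman–Duminil-Copin 2021,
eq. (3.11), with footnote 5). For `β > 0`: the box identities `connectedFour_free_box_eq` and the
passage to the limit `tendsto_sourcedDoubleCurrentLaw_real_openConn` (no percolation of the sourced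
infinite-volume double current: source insertion in both currents and the sourceless statement,
ADS15 Thm. 3.1 with `m*(β) = 0` on `[0, β_c]`). At `β = 0` all currents vanish: both sides are `0`
unless `x = y` and `z = t`, where `P^{∅,∅}_{Λ_L,0} = δ_∅ = P^{∅,∅}_0`. [cite: AizenmanDuminilCopinAnnals2021, eq. (3.11)] -/
theorem freeUrsellFour_eq_sourcedDoubleCurrent_holds : freeUrsellFour_eq_sourcedDoubleCurrent d := by
  intro hd β hβ hβc x y z t
  rcases hβ.lt_or_eq with hpos | h0
  · exact freeUrsellFour_eq_of_tendsto d hpos.le x y z t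
      (tendsto_sourcedDoubleCurrentLaw_real_openConn d hd hpos hβc x y z t)
  · subst h0
    by_cases hxy : x = y
    · by_cases hzt : z = t
      · subst hxy; subst hzt
        classical
        apply freeUrsellFour_eq_of_tendsto d le_rfl x x z z
        have hA : (({x} : Finset (Site d)) ∆ {x}) = ∅ := symmDiff_self _
        have hB : (({z} : Finset (Site d)) ∆ {z}) = ∅ := symmDiff_self _
        rw [hA, hB, sourcedDoubleCurrentLawInf_zero_beta d]
        refine tendsto_const_nhds.congr fun L => ?_
        rw [sourcedDoubleCurrentLaw_zero_beta_real d L (measurableSet_openConn_holds x z), measureReal_def,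
          Measure.dirac_apply' _ (measurableSet_openConn_holds x z), Set.indicator_apply]
        split_ifs <;> simp
      · have hfzt : freeExpect d 0 0 (spinMonomial ![z, t]) = 0 := freeExpect_zero_beta_spinMonomial_two d hzt
        have hP : Tendsto (fun L : ℕ =>
            (sourcedDoubleCurrentLaw d L 0 ({x} ∆ {y}) ({z} ∆ {t})).real (openConn x z)) atTop (𝓝 0) := by
          refine tendsto_const_nhds.congr' ?_
          filter_upwards [eventually_mem_box z] with L hz
          exact ((sourcedDoubleCurrentLaw_zero_beta_real_eq_zero_of_ne d hzt hz ({x} ∆ {y}) (openConn x z)).2).symm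
        rw [freeUrsellFour_eq_of_tendsto d le_rfl x y z t hP, hfzt]
        ring
    · have hfxy : freeExpect d 0 0 (spinMonomial ![x, y]) = 0 := freeExpect_zero_beta_spinMonomial_two d hxy
      have hP : Tendsto (fun L : ℕ =>
          (sourcedDoubleCurrentLaw d L 0 ({x} ∆ {y}) ({z} ∆ {t})).real (openConn x z)) atTop (𝓝 0) := by
        refine tendsto_const_nhds.congr' ?_
        filter_upwards [eventually_mem_box x] with L hx
        exact ((sourcedDoubleCurrentLaw_zero_beta_real_eq_zero_of_ne d hxy hx ({z} ∆ {t}) (openConn x z)).1).symm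
      rw [freeUrsellFour_eq_of_tendsto d le_rfl x y z t hP, hfxy]
      ring

end UrsellAssembly


end Literature.Probability.LatticeModels
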